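import Mathlib
import Literature.Barriers.PneNP.TSPExtensionComplexity
import Literature.Barriers.PneNP.TSPExtensionComplexityFaces
import Literature.Barriers.PneNP.ExtendedFormulationLinearImage
import Literature.Barriers.PneNP.ExtendedFormulationFaceCounting
import Literature.Combinatorics.Optimization.RegularPolygonPsdLifts
import Literature.Combinatorics.Optimization.SortingNetworkRestriction
import HarnessLib

/-!
# Reflection relations (Kaibel–Pashkovich 2011): `xc(conv(P ∪ σ_H P)) ≤ xc(P) + 2`, sequences of
# reflections, the signing of a polytope, and the regular `m`-gon has an extended formulation with
# `2⌈log₂ m⌉ + 2` inequalities (Ben-Tal–Nemirovski) — PROVED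

Source: V. Kaibel, K. Pashkovich, *Constructing extended formulations from reflection relations*,
IPCO 2011, LNCS 6655, 287–300 [KaibelPashkovich2011] (held text `paper:arxiv-1011.3597`, §§2–4.1.1,
arXiv pp. 5–9). Verbatim (§3, p. 7): "For `a ∈ ℝⁿ ∖ {0}` and `β ∈ ℝ` … The reflection at `H = H^=(a, β)`
is `ϱ_H : ℝⁿ → ℝⁿ` where `ϱ_H(x)` is the point with `ϱ_H(x) − x ∈ H^⊥` lying in the one-dimensional
linear subspace `H^⊥ = {λa | λ ∈ ℝ}` that is orthogonal to `H` and `⟨a, ϱ_H(x)⟩ = 2β − ⟨a, x⟩`. The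
reflection relation defined by `(a, β)` is `R_{a,β} = {(x, y) ∈ ℝⁿ × ℝⁿ : y − x ∈ (H^=(a,β))^⊥,
⟨a,x⟩ ≤ ⟨a,y⟩ ≤ 2β − ⟨a,x⟩}` … **Remark 2.** If `𝓡` is induced by a sequential polyhedral relation of
type `(n, …, n)` and length `r` consisting of reflection relations only, then, for every polyhedron
`P ⊆ ℝⁿ`, an extended formulation of `𝓡(P)` with `n' + r` variables and `f' + 2r` inequalities can be
constructed, provided one has at hands an extended formulation for `P` with `n'` variables and `f'`
inequalities. **Proposition 2.** … the reflection relation `R_{a,β}` is affinely generated by the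
identity map and the reflection `ϱ_H`. **Corollary 1.** If `P ⊆ ℝⁿ` is a polytope, then …
`R_{a,β}(P) = conv((P ∩ H^≤) ∪ ϱ_H(P ∩ H^≤))`. … `ϱ*_{H^≤}(y) = y` if `y ∈ H^≤`, `ϱ_H(y)` otherwise …
**Theorem 1.** Let the sequential polyhedral relation `(R_{H₁^≤}, …, R_{H_r^≤})` … induce the
polyhedral relation `𝓡`. For polytopes `P, Q ⊆ ℝⁿ` with `Q = conv(W)` for some `W ⊆ ℝⁿ` we have
`Q = 𝓡(P)` whenever the following two conditions are satisfied: 1. We have `P ⊆ Q` and `ϱ_{H_i}(Q) ⊆ Q`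
for all `i ∈ [r]`. 2. We have `ϱ*_{H₁^≤} ∘ ⋯ ∘ ϱ*_{H_r^≤}(w) ∈ P` for all `w ∈ W`." (§3, p. 8):
"**Theorem 2.** For each polytope `P ⊆ ℝⁿ` with `v.abs ∈ P` for each vertex `v` of `P` that admits an
extended formulation with `n'` variables and `f'` inequalities, there is an extended formulation of
`sign(P)` with `n' + n` variables and `f' + 2n` inequalities" (`sign(P) = conv ⋃_{ε ∈ {−,+}ⁿ} ε.P`).
(§4.1.1, p. 9): "**Theorem 3.** … In particular, we obtain an extended formulation of a regular `m`-gon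
with `⌈log(m)⌉ + 1` variables and `2⌈log(m)⌉ + 2` inequalities by choosing `P = {(1,0)}` in Theorem 3,
thus reproving a result due to Ben-Tal and Nemirovski [BN01]" (Proposition 4: the sequence
`(R_{H^≤_{π/m}}, R_{H^≤_{2π/m}}, R_{H^≤_{4π/m}}, …, R_{H^≤_{2^r π/m}})`, `r = ⌈log(m)⌉`,
`H_φ = H^=((−sin φ, cos φ), 0)`).

## What is proved (no named fact)

Everything in the tree's slack-form currency `Literature.Barriers.PneNP.HasEFOfSize P r`
(`P = {x | ∃ y ∈ ℝ^r, y ≥ 0, E x + F y = g}`, size = number of sign-constrained variables; equations and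
free natural variables cost nothing, exactly as in Kaibel–Pashkovich's count of INEQUALITIES):

* `reflectAt a β` (the reflection `ϱ_H`), `reflRel a β` (the reflection relation, verbatim),
  `reflImage a β X = R_{a,β}(X)`; `mem_reflRel_iff` (parametrisation `y = x + t a`, `t ≥ 0`,
  `2⟨a,x⟩ + t⟨a,a⟩ ≤ 2β`), domain `H^≤` (`dotProduct_le_of_mem_reflRel`, `self_mem_reflRel`,
  `reflectAt_mem_reflRel`), Proposition 2 (`KaibelPashkovich2011_prop2`: the fibre of `x ∈ H^≤` is the
  segment `[x, ϱ_H x]`), Corollary 1 (`KaibelPashkovich2011_cor1`, for every CONVEX `P`);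
* EF calculus: `hasEFOfSize_nonnegOrthant`, `hasEFOfSize_singleton`, `HasEFOfSize.inter_halfSpace` (one
  more inequality costs `1`), `HasEFOfSize.prodRay`, `HasEFOfSize.reflImage` (**Remark 2, one step: `xc(R_{a,β}(P)) ≤ xc(P) + 2`**),
  `HasEFOfSize.seqImage` (length-`r` sequences: `+ 2r`);
* sequences: `seqImage l P = 𝓡(P)`, the canonical preimage `canon` / `canonSeq` (`ϱ*`), eq. (3)
  (`mem_seqImage_of_canonSeq_mem`) and **Theorem 1** (`KaibelPashkovich2011_thm1`);
* **Theorem 2 / Proposition 3** (`KaibelPashkovich2011_prop3`, `KaibelPashkovich2011_thm2`): the signing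
  `signing P = conv ⋃_S flipSigns S '' P` has an EF of size `r + 2|ι|` whenever `P = conv V` with
  `|v| ∈ P` for all `v ∈ V` (stated with a generating set `V` in place of "the vertices of `P`", which
  is the case `V = vert(P)`);
* **§4.1.1, Proposition 4 / Theorem 3 for `P` = one vertex** (namespace `RegularPolygon`, on the
  tree's regular `N`-gon of `RegularPolygonPsdLifts.lean`: `vertex N i = (cos θ_i, sin θ_i)`,
  `θ_i = (2i+1)π/N`, `polygon N`, `polygon_eq_convexHull`): `RegularPolygon.vertexZ` (integer-indexed
  vertices), `RegularPolygon.mirrors N n` (the lines at angles `(2^s+1)π/N`, `s < n` — Kaibel–Pashkovich's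
  `H_{2^s π/m}` after the rotation by `π/N` that takes their vertex `(1,0)` to `vertex N 0`),
  `RegularPolygon.seqImage_mirrors_singleton` (the `⌈log₂ N⌉ + 1` reflection relations map the point
  `vertex N 0` onto `conv X_N`) and **`RegularPolygon.hasEFOfSize_convexHull_vertex :
  HasEFOfSize (convexHull ℝ (range (vertex N))) (2 * Nat.clog 2 N + 2)`** for every `N ≥ 1`,
  **`RegularPolygon.hasEFOfSize_polygon : HasEFOfSize (polygon N) (2 * Nat.clog 2 N + 2)`** (`N ≥ 3`)
  — the Ben-Tal–Nemirovski / Kaibel–Pashkovich `O(log N)` LINEAR formulation, next to the psd lift of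
  size `2 log₂ N − 1` of `RegularPolygon.hasPsdLift_polygon` (Fawzi–Saunderson–Parrilo); together with
  Goemans' face counting (`HasEFOfSize.natCard_extremePoints_le`) the matching lower bound
  `RegularPolygon.le_two_pow_of_hasEFOfSize(_polygon) : HasEFOfSize … r → N ≤ 2 ^ r`, i.e.
  `log₂ N ≤ xc(regular N-gon) ≤ 2⌈log₂ N⌉ + 2`.

* **§4.1.3 (appended section `Bn`)**: Theorem 2 applied to the three `B_n`-polytopes named there —
  `hasEFOfSize_cube` (`conv{−1,+1}ⁿ = signing {𝟙}`: `2n` inequalities), `hasEFOfSize_crossPolytope`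
  (`conv{±e_i} = signing (stdSimplex)`: `3n`), and **Theorem 5 for the point `(1, …, n)`**:
  `KaibelPashkovich2011_thm5_point : HasEFOfSize (signing (permutahedron n)) (2n(⌈log₂ n⌉²+4) + 2n)`
  (the `B_n`-permutahedron = all signed permutations, `signing_permutahedron_eq`), on top of the
  tree's sorting-network formulation `ComparatorNetwork.hasEFOfSize_permutahedron_nlogsq`.

* **§4.1.2 and §4.1.3 for a general polytope (appended section `An`)**: the `A_{n−1}`-permutahedron
  `permHull P = conv ⋃_σ {x ∘ σ : x ∈ P}`, `sortVec y = sort(y)` (via `Tuple.sort`), the transposition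
  relations `T_{k,ℓ} = R_{e_k − e_ℓ, 0}` (`transVec`, `reflectAt_transVec`: the reflection swaps the
  coordinates; `canon_transVec`: the canonical preimage map IS the tree's comparator
  `ComparatorNetwork.comparator (k, ℓ)`), `transSeq N` (the sequence of a comparator network of
  `PermutahedronSortingNetworkEF.lean`, `canonSeq_transSeq : canonSeq (transSeq N) y = N.apply y`, so
  Kaibel–Pashkovich's sorting networks are exactly the tree's `ComparatorNetwork.IsSorting`,
  `IsSorting.apply_eq_sortVec`), **Proposition 5** (`KaibelPashkovich2011_prop5 : seqImage (transSeq N) P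
  = permHull P` for sorting `N`, `P = conv V`, `sort(v) ∈ P`), **Theorem 4** (`KaibelPashkovich2011_thm4 :
  HasEFOfSize P r → HasEFOfSize (permHull P) (r + 2|N|)`; unconditionally with Batcher's network
  `KaibelPashkovich2011_thm4_nlogsq : … (r + n(⌈log₂ n⌉² + 4))`; the point case
  `KaibelPashkovich2011_thm4_point` re-derives `ComparatorNetwork.Goemans2015_thm2`, `permHull_singleton_sortedVec`),
  the `B_n`-permutahedron `signPermHull P = conv ⋃_{σ,S} {(flipSigns S x) ∘ σ}`, **Proposition 6**
  (`KaibelPashkovich2011_prop6 : seqImage (transSeq N ++ signSeq (Fin n)) P = signPermHull P` when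
  `sort(|v|) ∈ P`) and **Theorem 5** (`KaibelPashkovich2011_thm5 : … (r + 2|N| + 2n)`,
  `KaibelPashkovich2011_thm5_nlogsq`, `signPermHull_singleton_sortedVec`).

Deviations from print. (i) Theorem 1 is proved directly for sequences of reflection relations (the
"⊆" half through Proposition 2 and convexity, the "⊇" half through eq. (3)), not through the general
Lemma 1 on affinely generated polyhedral relations, whose proof the extended abstract omits; `Q` need
only be `conv W` (any `W`), `P` any convex set. (ii) The hypothesis `a ≠ 0` of §3 is carried explicitly
where it is used (for `a = 0` the relation `R_{0,β}` is the identity or empty). (iii) Proposition 4 is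
formalised for `P` = a single vertex (the "in particular" of Theorem 3), in the tree's normalisation
of the regular `N`-gon (vertices at the odd multiples of `π/N`, i.e. Kaibel–Pashkovich's picture
rotated by `π/N`; extension complexity is invariant under rotations anyway,
`HasEFOfSize.image_linearEquiv_iff`); the invariant behind "Observing that `ϱ* ∘ ⋯ ∘ ϱ*(w)` is
contained in `Φ_{I₂(m)}`" is made explicit on vertex indices: after the conditional reflection at
the `s`-th mirror the current vertex `j` satisfies `0 ≤ 2j ≤ 2^s` (`RegularPolygon.canon_vertexZ_top`,
`RegularPolygon.canon_vertexZ_step`). (iv) In §§4.1.2–4.1.3 the comparator networks of the tree may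
contain degenerate comparators `(k, k)` (no-ops); `transSeq` drops them, so `|transSeq N| ≤ |N|`, and
the `O(n log n)` of Theorems 4 and 5 (AKS) is replaced by an explicit network size resp. Batcher's
`n(⌈log₂ n⌉² + 4)`. TODO(general form): Theorem 3 for an arbitrary polytope `P` meeting the
fundamental domain, §4.1.4 (`D_n`) and §4.4 (Huffman polytopes) are not formalised here.
Honest framing: Literature infrastructure on extended formulations; nothing here bears on `P ≠ NP`.
-/

noncomputable section

namespace Literature.Combinatorics.Optimization

open Matrix Finset Literature.Barriers.PneNP

variable {ι : Type} [Fintype ι]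

/-! ### Reflections -/

/-- `⟨a, a⟩ > 0` for `a ≠ 0`. [folklore] -/
private theorem dotProduct_self_pos_of_ne_zero {a : ι → ℝ} (ha : a ≠ 0) : 0 < a ⬝ᵥ a := by
  have h0 : 0 ≤ a ⬝ᵥ a := Finset.sum_nonneg fun i _ => mul_self_nonneg (a i)
  rcases h0.lt_or_eq with h | h
  · exact h
  · exact absurd (dotProduct_self_eq_zero.1 h.symm) ha

/-- The reflection `ϱ_H` at the hyperplane `H = H^=(a, β) = {x | ⟨a, x⟩ = β}`:
`ϱ_H(x) = x + (2(β − ⟨a,x⟩)/⟨a,a⟩) a`, the point on the line `x + ℝa` with `⟨a, ϱ_H(x)⟩ = 2β − ⟨a, x⟩`.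
[cite: KaibelPashkovich2011, §3 (arXiv p. 7)] -/
def reflectAt (a : ι → ℝ) (β : ℝ) (x : ι → ℝ) : ι → ℝ :=
  x + ((2 * (β - a ⬝ᵥ x)) / (a ⬝ᵥ a)) • a

/-- `⟨a, ϱ_H(x)⟩ = 2β − ⟨a, x⟩`. [cite: KaibelPashkovich2011, §3 (arXiv p. 7)] -/
theorem dotProduct_reflectAt {a : ι → ℝ} (ha : a ≠ 0) (β : ℝ) (x : ι → ℝ) :
    a ⬝ᵥ reflectAt a β x = 2 * β - a ⬝ᵥ x := by
  have hne : a ⬝ᵥ a ≠ 0 := (dotProduct_self_pos_of_ne_zero ha).ne'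
  simp only [reflectAt, dotProduct_add, dotProduct_smul, smul_eq_mul]
  field_simp
  ring

/-- `ϱ_H` is an involution. [cite: KaibelPashkovich2011, §3 (arXiv p. 7)] -/
theorem reflectAt_reflectAt {a : ι → ℝ} (ha : a ≠ 0) (β : ℝ) (x : ι → ℝ) :
    reflectAt a β (reflectAt a β x) = x := by
  have hne : a ⬝ᵥ a ≠ 0 := (dotProduct_self_pos_of_ne_zero ha).ne'
  ext i
  simp only [reflectAt, Pi.add_apply, Pi.smul_apply, smul_eq_mul, dotProduct_add, dotProduct_smul]
  field_simp
  ring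

/-- `ϱ_H` fixes `H` pointwise. [cite: KaibelPashkovich2011, §3 (arXiv p. 7)] -/
theorem reflectAt_of_dotProduct_eq {a : ι → ℝ} {β : ℝ} {x : ι → ℝ} (h : a ⬝ᵥ x = β) :
    reflectAt a β x = x := by
  simp [reflectAt, h]

/-- For `β = 0` the reflection `ϱ_H` is a linear map. [cite: KaibelPashkovich2011, §4.1 (arXiv p. 9: reflection groups, `0 ∈ H_i`)] -/
def reflectLin (a : ι → ℝ) : (ι → ℝ) →ₗ[ℝ] (ι → ℝ) where
  toFun := reflectAt a 0
  map_add' x y := by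
    ext i
    simp only [reflectAt, dotProduct_add, Pi.add_apply, Pi.smul_apply, smul_eq_mul]
    ring
  map_smul' c x := by
    ext i
    simp only [reflectAt, dotProduct_smul, Pi.add_apply, Pi.smul_apply, smul_eq_mul,
      RingHom.id_apply]
    ring

/-- `reflectLin a x = ϱ_{H^=(a,0)}(x)`. [cite: KaibelPashkovich2011, §4.1 (arXiv p. 9)] -/
@[simp] theorem reflectLin_apply (a x : ι → ℝ) : reflectLin a x = reflectAt a 0 x := rfl

/-! ### Reflection relations (§3) -/

/-- The **reflection relation** `R_{a,β} = {(x, y) : y − x ∈ ℝa, ⟨a,x⟩ ≤ ⟨a,y⟩ ≤ 2β − ⟨a,x⟩}`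
(verbatim). [cite: KaibelPashkovich2011, §3 (arXiv p. 7)] -/
def reflRel (a : ι → ℝ) (β : ℝ) : Set ((ι → ℝ) × (ι → ℝ)) :=
  {p | (∃ t : ℝ, p.2 - p.1 = t • a) ∧ a ⬝ᵥ p.1 ≤ a ⬝ᵥ p.2 ∧ a ⬝ᵥ p.2 ≤ 2 * β - a ⬝ᵥ p.1}

/-- The image `R_{a,β}(X) = {y | (x, y) ∈ R_{a,β} for some x ∈ X}` of a set under the reflection
relation (§2: "The image of a subset `X ⊆ ℝⁿ` under such a polyhedral relation").
[cite: KaibelPashkovich2011, §2 (arXiv p. 5)] -/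
def reflImage (a : ι → ℝ) (β : ℝ) (X : Set (ι → ℝ)) : Set (ι → ℝ) :=
  {y | ∃ x ∈ X, (x, y) ∈ reflRel a β}

/-- Parametrisation of the reflection relation: `(x, y) ∈ R_{a,β}` iff `y = x + t a` for some `t ≥ 0`
with `2⟨a,x⟩ + t⟨a,a⟩ ≤ 2β` (valid also for `a = 0`). [cite: KaibelPashkovich2011, §3 (arXiv p. 7)] -/
theorem mem_reflRel_iff {a : ι → ℝ} {β : ℝ} {x y : ι → ℝ} :
    (x, y) ∈ reflRel a β ↔
      ∃ t : ℝ, 0 ≤ t ∧ y = x + t • a ∧ 2 * (a ⬝ᵥ x) + t * (a ⬝ᵥ a) ≤ 2 * β := by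
  constructor
  · rintro ⟨⟨t, ht⟩, h1, h2⟩
    have hy : y = x + t • a := by rw [← ht]; abel
    have hay : a ⬝ᵥ y = a ⬝ᵥ x + t * (a ⬝ᵥ a) := by
      rw [hy, dotProduct_add, dotProduct_smul, smul_eq_mul]
    by_cases ha : a = 0
    · subst ha
      refine ⟨0, le_rfl, by simpa using hy, ?_⟩
      simp at h2 ⊢
      linarith
    · have hpos := dotProduct_self_pos_of_ne_zero ha
      refine ⟨t, ?_, hy, by linarith⟩
      by_contra hneg
      have := mul_neg_of_neg_of_pos (not_le.1 hneg) hpos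
      linarith
  · rintro ⟨t, ht, rfl, hle⟩
    have hay : a ⬝ᵥ (x + t • a) = a ⬝ᵥ x + t * (a ⬝ᵥ a) := by
      rw [dotProduct_add, dotProduct_smul, smul_eq_mul]
    have h0 : 0 ≤ a ⬝ᵥ a := Finset.sum_nonneg fun i _ => mul_self_nonneg (a i)
    refine ⟨⟨t, by rw [add_sub_cancel_left]⟩, ?_, ?_⟩
    · rw [hay]; nlinarith
    · rw [hay]; linarith

/-- The domain of `R_{a,β}` is the halfspace `H^≤ = {x | ⟨a,x⟩ ≤ β}`: "`(x,y) ∈ R_{a,β}` implies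
`⟨a,x⟩ ≤ 2β − ⟨a,x⟩`, thus `⟨a,x⟩ ≤ β`". [cite: KaibelPashkovich2011, §3 (arXiv p. 7)] -/
theorem dotProduct_le_of_mem_reflRel {a : ι → ℝ} {β : ℝ} {x y : ι → ℝ} (h : (x, y) ∈ reflRel a β) :
    a ⬝ᵥ x ≤ β := by
  obtain ⟨-, h1, h2⟩ := h
  dsimp only at h1 h2
  linarith

/-- "for each `x ∈ H^≤(a,β)`, we obviously have `(x, x) ∈ R_{a,β}`". [cite: KaibelPashkovich2011, §3 (arXiv p. 7)] -/
theorem self_mem_reflRel {a : ι → ℝ} {β : ℝ} {x : ι → ℝ} (hx : a ⬝ᵥ x ≤ β) :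
    (x, x) ∈ reflRel a β :=
  ⟨⟨0, by simp⟩, le_rfl, by dsimp only; linarith⟩

/-- For `x ∈ H^≤`, `(x, ϱ_H(x)) ∈ R_{a,β}`. [cite: KaibelPashkovich2011, Prop. 2 (arXiv p. 7)] -/
theorem reflectAt_mem_reflRel {a : ι → ℝ} (ha : a ≠ 0) {β : ℝ} {x : ι → ℝ} (hx : a ⬝ᵥ x ≤ β) :
    (x, reflectAt a β x) ∈ reflRel a β := by
  refine ⟨⟨2 * (β - a ⬝ᵥ x) / (a ⬝ᵥ a), by simp [reflectAt]⟩, ?_, ?_⟩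
  · dsimp only
    rw [dotProduct_reflectAt ha]
    linarith
  · dsimp only
    rw [dotProduct_reflectAt ha]

/-- For `y ∉ int H^≤` (i.e. `β ≤ ⟨a,y⟩`), `(ϱ_H(y), y) ∈ R_{a,β}` — the second case of eq. (3).
[cite: KaibelPashkovich2011, §3 eq. (3) (arXiv p. 7)] -/
theorem reflectAt_self_mem_reflRel {a : ι → ℝ} (ha : a ≠ 0) {β : ℝ} {y : ι → ℝ} (hy : β ≤ a ⬝ᵥ y) :
    (reflectAt a β y, y) ∈ reflRel a β := by
  refine ⟨⟨-(2 * (β - a ⬝ᵥ y) / (a ⬝ᵥ a)), ?_⟩, ?_, ?_⟩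
  · dsimp only
    rw [reflectAt, neg_smul]
    abel
  · dsimp only
    rw [dotProduct_reflectAt ha]
    linarith
  · dsimp only
    rw [dotProduct_reflectAt ha]
    linarith

/-- The fibre `R_{a,β}(x)` lies on the segment `[x, ϱ_H(x)]` ("we hence conclude that `y` is a convex
combination of `x` and `ϱ_H(x)`"). [cite: KaibelPashkovich2011, Prop. 2 (arXiv p. 7)] -/
theorem mem_segment_of_mem_reflRel {a : ι → ℝ} {β : ℝ} {x y : ι → ℝ} (h : (x, y) ∈ reflRel a β) :
    y ∈ segment ℝ x (reflectAt a β x) := by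
  obtain ⟨t, ht0, rfl, hle⟩ := mem_reflRel_iff.1 h
  by_cases ha : a = 0
  · subst ha
    rw [smul_zero, add_zero]
    exact left_mem_segment _ _ _
  have hpos := dotProduct_self_pos_of_ne_zero ha
  set c : ℝ := 2 * (β - a ⬝ᵥ x) / (a ⬝ᵥ a) with hc
  have htc : t ≤ c := by
    rw [hc, le_div_iff₀ hpos]
    linarith
  rcases eq_or_lt_of_le ht0 with h0 | htpos
  · rw [← h0, zero_smul, add_zero]
    exact left_mem_segment _ _ _
  have hcpos : 0 < c := lt_of_lt_of_le htpos htc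
  have hc0 : c ≠ 0 := hcpos.ne'
  refine ⟨1 - t / c, t / c, by rw [sub_nonneg, div_le_one hcpos]; exact htc, by positivity,
    by ring, ?_⟩
  ext i
  simp only [reflectAt, ← hc, Pi.add_apply, Pi.smul_apply, smul_eq_mul]
  field_simp
  ring

/-- **KP11 Proposition 2** (the reflection relation is affinely generated by `id` and `ϱ_H`): for
`x ∈ H^≤`, `R_{a,β}(x) = conv{x, ϱ_H(x)}`. [cite: KaibelPashkovich2011, Prop. 2 (arXiv p. 7)] -/
theorem KaibelPashkovich2011_prop2 {a : ι → ℝ} (ha : a ≠ 0) {β : ℝ} {x : ι → ℝ} (hx : a ⬝ᵥ x ≤ β) :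
    {y | (x, y) ∈ reflRel a β} = segment ℝ x (reflectAt a β x) := by
  apply Set.Subset.antisymm
  · intro y hy
    exact mem_segment_of_mem_reflRel hy
  · -- the fibre is convex and contains both endpoints
    have hconv : Convex ℝ {y | (x, y) ∈ reflRel a β} := by
      intro y₁ h₁ y₂ h₂ p q hp hq hpq
      obtain ⟨t₁, ht₁, rfl, hle₁⟩ := mem_reflRel_iff.1 h₁
      obtain ⟨t₂, ht₂, rfl, hle₂⟩ := mem_reflRel_iff.1 h₂
      rw [Set.mem_setOf_eq, mem_reflRel_iff]
      refine ⟨p * t₁ + q * t₂, by positivity, ?_, ?_⟩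
      · ext i
        simp only [Pi.add_apply, Pi.smul_apply, smul_eq_mul]
        linear_combination (x i) * hpq
      · have e1 := mul_le_mul_of_nonneg_left hle₁ hp
        have e2 := mul_le_mul_of_nonneg_left hle₂ hq
        have hβ : p * (2 * β) + q * (2 * β) = 2 * β := by rw [← add_mul, hpq, one_mul]
        calc 2 * (a ⬝ᵥ x) + (p * t₁ + q * t₂) * (a ⬝ᵥ a)
            = p * (2 * (a ⬝ᵥ x) + t₁ * (a ⬝ᵥ a)) + q * (2 * (a ⬝ᵥ x) + t₂ * (a ⬝ᵥ a)) := by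
              linear_combination (-(2 * (a ⬝ᵥ x))) * hpq
          _ ≤ p * (2 * β) + q * (2 * β) := add_le_add e1 e2
          _ = 2 * β := hβ
    exact hconv.segment_subset (self_mem_reflRel hx) (reflectAt_mem_reflRel ha hx)

/-- The image of a convex set under a reflection relation is convex (it is a linear projection of
`R ∩ (X × ℝⁿ)`, §2). [cite: KaibelPashkovich2011, §2 (arXiv p. 5)] -/
theorem convex_reflImage {X : Set (ι → ℝ)} (hX : Convex ℝ X) (a : ι → ℝ) (β : ℝ) :
    Convex ℝ (reflImage a β X) := by
  intro y₁ h₁ y₂ h₂ p q hp hq hpq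
  obtain ⟨x₁, hx₁, hr₁⟩ := h₁
  obtain ⟨x₂, hx₂, hr₂⟩ := h₂
  obtain ⟨t₁, ht₁, rfl, hle₁⟩ := mem_reflRel_iff.1 hr₁
  obtain ⟨t₂, ht₂, rfl, hle₂⟩ := mem_reflRel_iff.1 hr₂
  refine ⟨p • x₁ + q • x₂, hX hx₁ hx₂ hp hq hpq, mem_reflRel_iff.2 ⟨p * t₁ + q * t₂, by positivity,
    ?_, ?_⟩⟩
  · ext i
    simp only [Pi.add_apply, Pi.smul_apply, smul_eq_mul]
    ring
  · have e1 := mul_le_mul_of_nonneg_left hle₁ hp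
    have e2 := mul_le_mul_of_nonneg_left hle₂ hq
    have hβ : p * (2 * β) + q * (2 * β) = 2 * β := by rw [← add_mul, hpq, one_mul]
    calc 2 * (a ⬝ᵥ (p • x₁ + q • x₂)) + (p * t₁ + q * t₂) * (a ⬝ᵥ a)
        = p * (2 * (a ⬝ᵥ x₁) + t₁ * (a ⬝ᵥ a)) + q * (2 * (a ⬝ᵥ x₂) + t₂ * (a ⬝ᵥ a)) := by
          rw [dotProduct_add, dotProduct_smul, dotProduct_smul, smul_eq_mul, smul_eq_mul]
          ring
      _ ≤ p * (2 * β) + q * (2 * β) := add_le_add e1 e2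
      _ = 2 * β := hβ

/-- `x ↦ ⟨a, x⟩` is linear. [folklore] -/
private theorem isLinearMap_dotProduct (a : ι → ℝ) : IsLinearMap ℝ fun x : ι → ℝ => a ⬝ᵥ x :=
  ⟨fun x y => dotProduct_add a x y, fun c x => dotProduct_smul c a x⟩

/-- Monotonicity `X ⊆ X' ⇒ R(X) ⊆ R(X')` (§2). [cite: KaibelPashkovich2011, §2 (arXiv p. 5)] -/
theorem reflImage_mono {X X' : Set (ι → ℝ)} (h : X ⊆ X') (a : ι → ℝ) (β : ℝ) :
    reflImage a β X ⊆ reflImage a β X' := by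
  rintro y ⟨x, hx, hxy⟩
  exact ⟨x, h hx, hxy⟩

/-- The image only depends on `X ∩ H^≤` (the domain of the relation).
[cite: KaibelPashkovich2011, §2–3 (arXiv pp. 6–7: "`R(X) = ⋃_{x ∈ X ∩ dom(R)} R(x)`", "`dom(R_{a,β}) = H^≤`")] -/
theorem reflImage_inter_halfSpace (a : ι → ℝ) (β : ℝ) (X : Set (ι → ℝ)) :
    reflImage a β (X ∩ {x | a ⬝ᵥ x ≤ β}) = reflImage a β X := by
  apply Set.Subset.antisymm (reflImage_mono Set.inter_subset_left a β)
  rintro y ⟨x, hx, hxy⟩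
  exact ⟨x, ⟨hx, dotProduct_le_of_mem_reflRel hxy⟩, hxy⟩

/-- **KP11 Corollary 1**, for every convex `P` (in particular every polytope): with
`P' = P ∩ H^≤`, `R_{a,β}(P) = conv(P' ∪ ϱ_H(P'))`. [cite: KaibelPashkovich2011, Cor. 1 (arXiv p. 7)] -/
theorem KaibelPashkovich2011_cor1 {P : Set (ι → ℝ)} (hP : Convex ℝ P) {a : ι → ℝ} (ha : a ≠ 0)
    (β : ℝ) :
    reflImage a β P =
      convexHull ℝ ((P ∩ {x | a ⬝ᵥ x ≤ β}) ∪ reflectAt a β '' (P ∩ {x | a ⬝ᵥ x ≤ β})) := by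
  apply Set.Subset.antisymm
  · rintro y ⟨x, hx, hxy⟩
    have hx' : x ∈ P ∩ {z | a ⬝ᵥ z ≤ β} := Set.mem_inter hx (dotProduct_le_of_mem_reflRel hxy)
    exact segment_subset_convexHull (Set.mem_union_left _ hx')
      (Set.mem_union_right _ (Set.mem_image_of_mem (reflectAt a β) hx'))
      (mem_segment_of_mem_reflRel hxy)
  · rw [← reflImage_inter_halfSpace]
    refine convexHull_min ?_
      (convex_reflImage (hP.inter (convex_halfSpace_le (isLinearMap_dotProduct a) β)) a β)
    rintro y (hy | ⟨x, hx, rfl⟩)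
    · exact ⟨y, hy, self_mem_reflRel hy.2⟩
    · exact ⟨x, hx, reflectAt_mem_reflRel ha hx.2⟩

/-! ### The extended formulation of a reflection image (Remark 2) -/

/-- The nonnegative orthant `{x | x ≥ 0} ⊆ ℝ^κ` has a slack-form EF with `|κ|` inequalities
(`x − y = 0`, `y ≥ 0`; "The size of an EF is defined as its number of inequalities").
[cite: FioriniEtAl2015, §1 (PDF p. 3: slack form (1), size)] -/
theorem hasEFOfSize_nonnegOrthant (κ : Type) [Fintype κ] :
    HasEFOfSize {x : κ → ℝ | ∀ k, 0 ≤ x k} (Fintype.card κ) := by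
  classical
  have h0 := hasEFOfSize_of_system (ι := κ) (1 : Matrix κ κ ℝ) (-1 : Matrix κ κ ℝ) 0
  convert h0 using 1
  ext x
  simp only [Set.mem_setOf_eq, neg_mulVec, one_mulVec, add_neg_eq_zero]
  constructor
  · intro hx
    exact ⟨x, hx, rfl⟩
  · rintro ⟨y, hy, rfl⟩
    exact hy

/-- A single point has a slack-form EF with `0` inequalities (`x = p`, no slack variables) — the
extended formulation of `P = {(1,0)}` with "`f' = 0`" inequalities in Theorem 3.
[cite: KaibelPashkovich2011, Thm. 3 (arXiv p. 9)] -/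
theorem hasEFOfSize_singleton (p : ι → ℝ) : HasEFOfSize ({p} : Set (ι → ℝ)) 0 := by
  classical
  have h0 := hasEFOfSize_of_system (ι := ι) (1 : Matrix ι ι ℝ) (0 : Matrix ι (Fin 0) ℝ) p
  rw [Fintype.card_fin] at h0
  convert h0 using 1
  ext x
  simp only [Set.mem_singleton_iff, Set.mem_setOf_eq, one_mulVec, Matrix.zero_mulVec, add_zero]
  constructor
  · rintro rfl
    exact ⟨Fin.elim0, fun j => Fin.elim0 j, rfl⟩
  · rintro ⟨-, -, rfl⟩
    rfl

/-- **One more inequality costs one**: `HasEFOfSize P r → HasEFOfSize (P ∩ {x | ⟨c,x⟩ ≤ δ}) (r + 1)`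
(add a slack variable `s ≥ 0` and the row `⟨c,x⟩ + s = δ` to the system). This is the count behind
Remark 1 / Remark 2 ("`f' + f₁ + ⋯ + f_r` constraints"). [cite: KaibelPashkovich2011, Remark 1 (arXiv p. 5)] -/
theorem _root_.Literature.Barriers.PneNP.HasEFOfSize.inter_halfSpace {P : Set (ι → ℝ)} {r : ℕ}
    (h : HasEFOfSize P r) (c : ι → ℝ) (δ : ℝ) :
    HasEFOfSize (P ∩ {x | c ⬝ᵥ x ≤ δ}) (r + 1) := by
  classical
  obtain ⟨Q, hQ⟩ := h
  subst hQ
  have h0 := hasEFOfSize_of_system (ι := ι)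
    (Matrix.fromRows Q.E (Matrix.of fun (_ : Unit) i => c i))
    (Matrix.fromBlocks Q.F 0 0 (1 : Matrix Unit Unit ℝ)) (Sum.elim Q.g fun _ => δ)
  rw [Fintype.card_sum, Fintype.card_fin, Fintype.card_unit] at h0
  convert h0 using 1
  ext x
  have hc : (Matrix.of fun (_ : Unit) i => c i) *ᵥ x = fun _ => c ⬝ᵥ x := rfl
  simp only [Set.mem_inter_iff, Set.mem_setOf_eq, Matrix.fromRows_mulVec, Matrix.fromBlocks_mulVec,
    hc, Matrix.zero_mulVec, add_zero, zero_add, Matrix.one_mulVec,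
    sumElim_add_sumElim_eq_sumElim_iff]
  constructor
  · rintro ⟨⟨y, hy, hsys⟩, hcx⟩
    refine ⟨Sum.elim y fun _ => δ - c ⬝ᵥ x, ?_, hsys, ?_⟩
    · rintro (j | u)
      · exact hy j
      · simp only [Sum.elim_inr]
        linarith
    · funext u
      simp
  · rintro ⟨y, hy, h1, h2⟩
    refine ⟨⟨y ∘ Sum.inl, fun j => hy _, h1⟩, ?_⟩
    have := congrFun h2 ()
    simp only [Pi.add_apply, Function.comp_apply] at this
    linarith [hy (Sum.inr ())]

/-- Appending one free-but-nonnegative coordinate costs one inequality: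
`HasEFOfSize P r → HasEFOfSize {(x, t) | x ∈ P, t ≥ 0} (r + 1)` (coordinates `ι ⊕ Unit`; the extra
variable of a reflection relation, Remark 2: "`n' + r` variables"). [cite: KaibelPashkovich2011, Remark 2 (arXiv p. 7)] -/
theorem _root_.Literature.Barriers.PneNP.HasEFOfSize.prodRay {P : Set (ι → ℝ)} {r : ℕ}
    (h : HasEFOfSize P r) :
    HasEFOfSize {w : ι ⊕ Unit → ℝ | (fun i => w (Sum.inl i)) ∈ P ∧ 0 ≤ w (Sum.inr ())} (r + 1) := by
  classical
  obtain ⟨Q, hQ⟩ := h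
  subst hQ
  have h0 := hasEFOfSize_of_system (ι := ι ⊕ Unit)
    (Matrix.fromBlocks Q.E 0 0 (1 : Matrix Unit Unit ℝ))
    (Matrix.fromBlocks Q.F 0 0 (-1 : Matrix Unit Unit ℝ)) (Sum.elim Q.g 0)
  rw [Fintype.card_sum, Fintype.card_fin, Fintype.card_unit] at h0
  convert h0 using 1
  ext w
  simp only [Set.mem_setOf_eq, Matrix.fromBlocks_mulVec, Matrix.zero_mulVec, add_zero, zero_add,
    Matrix.one_mulVec, Matrix.neg_mulVec, sumElim_add_sumElim_eq_sumElim_iff]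
  constructor
  · rintro ⟨⟨y, hy, hsys⟩, hw⟩
    refine ⟨Sum.elim y fun _ => w (Sum.inr ()), ?_, hsys, ?_⟩
    · rintro (j | u)
      · exact hy j
      · simpa using hw
    · funext u
      simp
  · rintro ⟨y, hy, h1, h2⟩
    refine ⟨⟨y ∘ Sum.inl, fun j => hy _, h1⟩, ?_⟩
    have := congrFun h2 ()
    simp only [Pi.add_apply, Function.comp_apply, Pi.neg_apply, Pi.zero_apply] at this
    linarith [hy (Sum.inr ())]

/-- The linear map `(x, t) ↦ x + t a` on `ℝ^ι × ℝ` (coordinates `ι ⊕ Unit`). [folklore] -/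
def addRayMap (a : ι → ℝ) : (ι ⊕ Unit → ℝ) →ₗ[ℝ] (ι → ℝ) where
  toFun w := (fun i => w (Sum.inl i)) + w (Sum.inr ()) • a
  map_add' w w' := by
    ext i
    simp only [Pi.add_apply, Pi.smul_apply, smul_eq_mul]
    ring
  map_smul' c w := by
    ext i
    simp only [Pi.add_apply, Pi.smul_apply, smul_eq_mul, RingHom.id_apply]
    ring

/-- **KP11 Remark 2 (one reflection relation): `xc(R_{a,β}(P)) ≤ xc(P) + 2`.** In slack form:
`R_{a,β}(P)` is the image under `(x,t) ↦ x + t a` of `{(x,t) | x ∈ P, t ≥ 0, 2⟨a,x⟩ + t⟨a,a⟩ ≤ 2β}`,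
which costs the `r` inequalities of `P` plus `t ≥ 0` plus one slack.
[cite: KaibelPashkovich2011, Remark 2 (arXiv p. 7)] -/
theorem _root_.Literature.Barriers.PneNP.HasEFOfSize.reflImage {P : Set (ι → ℝ)} {r : ℕ}
    (h : HasEFOfSize P r) (a : ι → ℝ) (β : ℝ) : HasEFOfSize (reflImage a β P) (r + 2) := by
  classical
  have h1 := (h.prodRay.inter_halfSpace (Sum.elim ((2 : ℝ) • a) fun _ => a ⬝ᵥ a) (2 * β)).image_linearMap
    (addRayMap a)
  convert h1 using 1
  ext y
  simp only [Set.mem_image, Set.mem_inter_iff, Set.mem_setOf_eq]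
  constructor
  · rintro ⟨x, hx, hxy⟩
    obtain ⟨t, ht, rfl, hle⟩ := mem_reflRel_iff.1 hxy
    refine ⟨Sum.elim x fun _ => t, ⟨⟨by simpa using hx, by simpa using ht⟩, ?_⟩, ?_⟩
    · rw [sumElim_dotProduct_sumElim]
      have : (fun _ : Unit => a ⬝ᵥ a) ⬝ᵥ (fun _ : Unit => t) = t * (a ⬝ᵥ a) := by
        simp [dotProduct, mul_comm]
      rw [this, smul_dotProduct, smul_eq_mul]
      linarith
    · rfl
  · rintro ⟨w, ⟨⟨hwP, hwt⟩, hle⟩, rfl⟩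
    refine ⟨fun i => w (Sum.inl i), hwP, mem_reflRel_iff.2 ⟨w (Sum.inr ()), hwt, rfl, ?_⟩⟩
    have hw : w = Sum.elim (fun i => w (Sum.inl i)) (fun k => w (Sum.inr k)) := by
      funext s; rcases s with i | k <;> rfl
    rw [hw, sumElim_dotProduct_sumElim] at hle
    have : (fun _ : Unit => a ⬝ᵥ a) ⬝ᵥ (fun k => w (Sum.inr k)) = w (Sum.inr ()) * (a ⬝ᵥ a) := by
      simp [dotProduct, mul_comm]
    rw [this, smul_dotProduct, smul_eq_mul] at hle
    exact hle

/-! ### Sequences of reflection relations and Theorem 1 -/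

/-- The image `𝓡(X)` of `X` under the polyhedral relation induced by the sequence of reflection
relations `l = [(a₁,β₁), …, (a_r,β_r)]` (apply `R_{a₁,β₁}` first). [cite: KaibelPashkovich2011, §2 (arXiv p. 5)] -/
def seqImage : List ((ι → ℝ) × ℝ) → Set (ι → ℝ) → Set (ι → ℝ)
  | [], X => X
  | h :: t, X => seqImage t (reflImage h.1 h.2 X)

/-- `𝓡_{[]}(X) = X`. [cite: KaibelPashkovich2011, §2 (arXiv p. 5)] -/
@[simp] theorem seqImage_nil (X : Set (ι → ℝ)) : seqImage [] X = X := rfl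

/-- `𝓡_{h :: t}(X) = 𝓡_t(R_h(X))`. [cite: KaibelPashkovich2011, §2 (arXiv p. 5)] -/
@[simp] theorem seqImage_cons (h : (ι → ℝ) × ℝ) (t : List ((ι → ℝ) × ℝ)) (X : Set (ι → ℝ)) :
    seqImage (h :: t) X = seqImage t (reflImage h.1 h.2 X) := rfl

/-- The canonical preimage map `ϱ*_{H^≤}(y) = y` if `y ∈ H^≤`, `ϱ_H(y)` otherwise.
[cite: KaibelPashkovich2011, §3 (arXiv p. 7)] -/
def canon (a : ι → ℝ) (β : ℝ) (y : ι → ℝ) : ι → ℝ :=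
  if a ⬝ᵥ y ≤ β then y else reflectAt a β y

/-- `ϱ*_{H₁^≤} ∘ ⋯ ∘ ϱ*_{H_r^≤}` for the sequence `l = [H₁, …, H_r]` (the last relation's canonical
preimage is taken first). [cite: KaibelPashkovich2011, §3 eq. (3) (arXiv p. 7)] -/
def canonSeq : List ((ι → ℝ) × ℝ) → (ι → ℝ) → (ι → ℝ)
  | [], y => y
  | h :: t, y => canon h.1 h.2 (canonSeq t y)

/-- `ϱ*` always lands in `H^≤`. [cite: KaibelPashkovich2011, §3 (arXiv p. 7)] -/
theorem dotProduct_canon_le {a : ι → ℝ} (ha : a ≠ 0) (β : ℝ) (y : ι → ℝ) :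
    a ⬝ᵥ canon a β y ≤ β := by
  unfold canon
  split_ifs with hy
  · exact hy
  · rw [dotProduct_reflectAt ha]
    linarith [not_le.1 hy]

/-- Eq. (3), one step: `y ∈ R_{a,β}(ϱ*(y))`, hence `ϱ*(y) ∈ X ⇒ y ∈ R_{a,β}(X)`.
[cite: KaibelPashkovich2011, §3 eq. (3) (arXiv p. 7)] -/
theorem mem_reflImage_of_canon_mem {a : ι → ℝ} (ha : a ≠ 0) {β : ℝ} {X : Set (ι → ℝ)} {y : ι → ℝ}
    (h : canon a β y ∈ X) : y ∈ reflImage a β X := by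
  unfold canon at h
  split_ifs at h with hy
  · exact ⟨y, h, self_mem_reflRel hy⟩
  · exact ⟨_, h, reflectAt_self_mem_reflRel ha (le_of_lt (not_le.1 hy))⟩

/-- **Eq. (3)**: `y ∈ 𝓡(ϱ*_{H₁^≤} ∘ ⋯ ∘ ϱ*_{H_r^≤}(y))`, in the form `ϱ*⋯ϱ*(y) ∈ X ⇒ y ∈ 𝓡(X)`.
[cite: KaibelPashkovich2011, §3 eq. (3) (arXiv p. 7)] -/
theorem mem_seqImage_of_canonSeq_mem {l : List ((ι → ℝ) × ℝ)} (hl : ∀ h ∈ l, h.1 ≠ 0)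
    {X : Set (ι → ℝ)} {y : ι → ℝ} (h : canonSeq l y ∈ X) : y ∈ seqImage l X := by
  induction l generalizing X with
  | nil => exact h
  | cons hd t ih =>
    have hne : hd.1 ≠ 0 := hl hd (by simp)
    exact ih (fun h' hh' => hl h' (List.mem_cons_of_mem _ hh'))
      (mem_reflImage_of_canon_mem hne h)

/-- Images of convex sets under sequences of reflection relations are convex.
[cite: KaibelPashkovich2011, §2 (arXiv p. 5)] -/
theorem convex_seqImage {X : Set (ι → ℝ)} (hX : Convex ℝ X) (l : List ((ι → ℝ) × ℝ)) :
    Convex ℝ (seqImage l X) := by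
  induction l generalizing X with
  | nil => exact hX
  | cons hd t ih => exact ih (convex_reflImage hX hd.1 hd.2)

/-- **Remark 2 (sequences)**: an EF of `P` with `r` inequalities yields one of `𝓡(P)` with
`r + 2·(length of the sequence)` inequalities. [cite: KaibelPashkovich2011, Remark 2 (arXiv p. 7)] -/
theorem _root_.Literature.Barriers.PneNP.HasEFOfSize.seqImage {P : Set (ι → ℝ)} {r : ℕ}
    (h : HasEFOfSize P r) (l : List ((ι → ℝ) × ℝ)) :
    HasEFOfSize (seqImage l P) (r + 2 * l.length) := by
  induction l generalizing P r with
  | nil => simpa using h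
  | cons hd t ih =>
    rw [seqImage_cons, List.length_cons,
      show r + 2 * (t.length + 1) = (r + 2) + 2 * t.length by ring]
    exact ih (h.reflImage hd.1 hd.2)

/-- The "⊆" half of Theorem 1: if `X ⊆ Q`, `Q` is convex and closed under the reflections of the
sequence, then `𝓡(X) ⊆ Q` (Proposition 2: each fibre is a segment `[x, ϱ_H x] ⊆ Q`).
[cite: KaibelPashkovich2011, Thm. 1, proof (arXiv p. 7)] -/
theorem seqImage_subset {l : List ((ι → ℝ) × ℝ)} {X Q : Set (ι → ℝ)} (hQ : Convex ℝ Q) (hXQ : X ⊆ Q)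
    (hrefl : ∀ h ∈ l, ∀ x ∈ Q, reflectAt h.1 h.2 x ∈ Q) : seqImage l X ⊆ Q := by
  induction l generalizing X with
  | nil => exact hXQ
  | cons hd t ih =>
    refine ih ?_ fun h' hh' => hrefl h' (List.mem_cons_of_mem _ hh')
    rintro y ⟨x, hx, hxy⟩
    exact hQ.segment_subset (hXQ hx) (hrefl hd (by simp) x (hXQ hx)) (mem_segment_of_mem_reflRel hxy)

/-- **KP11 Theorem 1.** For a sequence of reflection relations at hyperplanes `H_i = H^=(a_i, β_i)`
(`a_i ≠ 0`), a convex `P` and `Q = conv W`: if (1) `P ⊆ Q` and `ϱ_{H_i}(Q) ⊆ Q` for all `i`, and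
(2) `ϱ*_{H₁^≤} ∘ ⋯ ∘ ϱ*_{H_r^≤}(w) ∈ P` for all `w ∈ W`, then `𝓡(P) = Q`.
[cite: KaibelPashkovich2011, Thm. 1 (arXiv p. 7)] -/
theorem KaibelPashkovich2011_thm1 {l : List ((ι → ℝ) × ℝ)} {P Q W : Set (ι → ℝ)}
    (hQW : Q = convexHull ℝ W) (hP : Convex ℝ P) (hPQ : P ⊆ Q) (hl : ∀ h ∈ l, h.1 ≠ 0)
    (hrefl : ∀ h ∈ l, ∀ x ∈ Q, reflectAt h.1 h.2 x ∈ Q) (hcanon : ∀ w ∈ W, canonSeq l w ∈ P) :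
    seqImage l P = Q := by
  apply Set.Subset.antisymm
  · exact seqImage_subset (by rw [hQW]; exact convex_convexHull ℝ W) hPQ hrefl
  · rw [hQW]
    exact convexHull_min (fun w hw => mem_seqImage_of_canonSeq_mem hl (hcanon w hw))
      (convex_seqImage hP l)

/-- `canonSeq (l ++ [h]) = canonSeq l ∘ ϱ*_h`. [cite: KaibelPashkovich2011, §3 (arXiv p. 7)] -/
theorem canonSeq_append_singleton (l : List ((ι → ℝ) × ℝ)) (h : (ι → ℝ) × ℝ) (y : ι → ℝ) :
    canonSeq (l ++ [h]) y = canonSeq l (canon h.1 h.2 y) := by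
  induction l with
  | nil => rfl
  | cons hd t ih => simp [canonSeq, ih]

/-! ### The signing of a polytope (Proposition 3, Theorem 2) -/

section Signing

variable [DecidableEq ι]

/-- `ε.x`: flip the signs of the coordinates in `S`. [cite: KaibelPashkovich2011, §3 (arXiv p. 8)] -/
def flipSigns (S : Finset ι) (x : ι → ℝ) : ι → ℝ := fun i => (if i ∈ S then -1 else 1) * x i

/-- `x.abs`: componentwise absolute value. [cite: KaibelPashkovich2011, §3 (arXiv p. 8)] -/
def absVec (x : ι → ℝ) : ι → ℝ := fun i => |x i|

/-- The **signing** `sign(P) = conv ⋃_{ε ∈ {−,+}ⁿ} ε.P`. [cite: KaibelPashkovich2011, §3 (arXiv pp. 7–8)] -/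
def signing (P : Set (ι → ℝ)) : Set (ι → ℝ) := convexHull ℝ (⋃ S : Finset ι, flipSigns S '' P)

/-- `flipSigns S` as a linear map. [cite: KaibelPashkovich2011, §3 (arXiv p. 8)] -/
def flipLin (S : Finset ι) : (ι → ℝ) →ₗ[ℝ] (ι → ℝ) where
  toFun := flipSigns S
  map_add' x y := by
    ext i
    simp only [flipSigns, Pi.add_apply]
    ring
  map_smul' c x := by
    ext i
    simp only [flipSigns, Pi.smul_apply, smul_eq_mul, RingHom.id_apply]
    ring

omit [Fintype ι] in
/-- `flipLin S x = ε.x`. [cite: KaibelPashkovich2011, §3 (arXiv p. 8)] -/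
@[simp] theorem flipLin_apply (S : Finset ι) (x : ι → ℝ) : flipLin S x = flipSigns S x := rfl

omit [Fintype ι] in
/-- `∅.x = x`. [cite: KaibelPashkovich2011, §3 (arXiv p. 8)] -/
@[simp] theorem flipSigns_empty (x : ι → ℝ) : flipSigns ∅ x = x := by
  ext i; simp [flipSigns]

omit [Fintype ι] in
/-- `|ε.x| = |x|`. [cite: KaibelPashkovich2011, Prop. 3, proof (arXiv p. 8: "`|w| = |v|`")] -/
@[simp] theorem absVec_flipSigns (S : Finset ι) (x : ι → ℝ) : absVec (flipSigns S x) = absVec x := by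
  ext i
  by_cases hi : i ∈ S <;> simp [absVec, flipSigns, hi]

omit [Fintype ι] in
/-- Two sign flips compose to a sign flip: `σ_k(ε.x) = ε'.x` with `ε' = ε` toggled at `k`.
[cite: KaibelPashkovich2011, §3 (arXiv p. 8)] -/
theorem flipSigns_singleton_flipSigns (k : ι) (S : Finset ι) (x : ι → ℝ) :
    flipSigns {k} (flipSigns S x) = flipSigns (if k ∈ S then S.erase k else insert k S) x := by
  ext i
  by_cases hk : k ∈ S
  · by_cases hik : i = k
    · subst hik; simp [flipSigns, hk]
    · by_cases hi : i ∈ S <;> simp [flipSigns, hk, hik, hi]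
  · by_cases hik : i = k
    · subst hik; simp [flipSigns, hk]
    · by_cases hi : i ∈ S <;> simp [flipSigns, hk, hik, hi]

/-- The reflection `σ_k` of `S_k = R_{−e_k, 0}` is the sign change of coordinate `k`.
[cite: KaibelPashkovich2011, §3 (arXiv p. 8)] -/
theorem reflectAt_neg_single (k : ι) (y : ι → ℝ) :
    reflectAt (-Pi.single k 1) 0 y = flipSigns {k} y := by
  have h1 : (-Pi.single k (1 : ℝ)) ⬝ᵥ y = -y k := by
    rw [neg_dotProduct, single_dotProduct, one_mul]
  have h2 : (-Pi.single k (1 : ℝ)) ⬝ᵥ (-Pi.single k 1) = 1 := by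
    rw [neg_dotProduct_neg, single_dotProduct, one_mul, Pi.single_eq_same]
  ext i
  rw [reflectAt, h1, h2]
  simp only [Pi.add_apply, Pi.smul_apply, Pi.neg_apply, smul_eq_mul, flipSigns,
    Finset.mem_singleton]
  by_cases hik : i = k
  · subst hik
    rw [if_pos rfl, Pi.single_eq_same]
    ring
  · rw [if_neg hik, Pi.single_eq_of_ne hik]
    ring

/-- The canonical preimage for `S_k` replaces `y_k` by `|y_k|`. [cite: KaibelPashkovich2011, §3 (arXiv p. 8)] -/
theorem canon_neg_single (k : ι) (y : ι → ℝ) :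
    canon (-Pi.single k 1) 0 y = Function.update y k |y k| := by
  have h1 : (-Pi.single k (1 : ℝ)) ⬝ᵥ y = -y k := by
    rw [neg_dotProduct, single_dotProduct, one_mul]
  unfold canon
  rw [h1]
  split_ifs with hy
  · rw [abs_of_nonneg (by linarith), Function.update_eq_self]
  · rw [reflectAt_neg_single, abs_of_neg (by linarith)]
    ext i
    by_cases hik : i = k
    · subst hik; simp [flipSigns]
    · simp [flipSigns, hik]

/-- The sequence `(S_k)_{k ∈ ι}` of sign reflection relations (some enumeration of the coordinates).
[cite: KaibelPashkovich2011, Prop. 3 (arXiv p. 8)] -/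
def signSeq (ι : Type) [Fintype ι] [DecidableEq ι] : List ((ι → ℝ) × ℝ) :=
  (Finset.univ : Finset ι).toList.map fun k => (-Pi.single k 1, 0)

/-- `signSeq` has one relation per coordinate. [cite: KaibelPashkovich2011, Thm. 2 (arXiv p. 8)] -/
theorem length_signSeq : (signSeq ι).length = Fintype.card ι := by
  simp [signSeq]

/-- `ϱ*_{S_{k₁}} ∘ ⋯ ∘ ϱ*_{S_{k_r}}` takes absolute values on the listed coordinates.
[cite: KaibelPashkovich2011, Prop. 3, proof (arXiv p. 8)] -/
theorem canonSeq_map_neg_single (L : List ι) (y : ι → ℝ) :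
    canonSeq (L.map fun k => ((-Pi.single k 1 : ι → ℝ), (0 : ℝ))) y =
      fun i => if i ∈ L then |y i| else y i := by
  induction L with
  | nil => simp [canonSeq]
  | cons k t ih =>
    rw [List.map_cons, canonSeq]
    dsimp only
    rw [ih, canon_neg_single]
    ext i
    by_cases hik : i = k
    · subst hik
      by_cases hi : i ∈ t <;> simp [hi]
    · rw [Function.update_of_ne hik]
      by_cases hi : i ∈ t <;> simp [hi, hik]

/-- "`ϱ*_{S₁} ∘ ⋯ ∘ ϱ*_{S_n}(w) = |w|`". [cite: KaibelPashkovich2011, Prop. 3, proof (arXiv p. 8)] -/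
theorem canonSeq_signSeq (y : ι → ℝ) : canonSeq (signSeq ι) y = absVec y := by
  rw [signSeq, canonSeq_map_neg_single]
  ext i
  simp [absVec]

omit [Fintype ι] in
/-- The signing of `conv V` is `conv ⋃_ε ε.V`. [cite: KaibelPashkovich2011, Prop. 3, proof (arXiv p. 8: "`Q = conv(W)` with `W = {ε.v}`")] -/
theorem signing_convexHull (V : Set (ι → ℝ)) :
    signing (convexHull ℝ V) = convexHull ℝ (⋃ S : Finset ι, flipSigns S '' V) := by
  apply Set.Subset.antisymm
  · refine convexHull_min ?_ (convex_convexHull ℝ _)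
    intro y hy
    obtain ⟨S, hyS⟩ := Set.mem_iUnion.1 hy
    have himg : flipSigns S '' convexHull ℝ V = convexHull ℝ (flipSigns S '' V) :=
      (flipLin S).image_convexHull V
    rw [himg] at hyS
    exact convexHull_mono (Set.subset_iUnion (fun S : Finset ι => flipSigns S '' V) S) hyS
  · exact convexHull_mono (Set.iUnion_mono fun S => Set.image_mono (subset_convexHull ℝ V))

omit [Fintype ι] in
/-- `sign(P)` is closed under every coordinate sign change. [cite: KaibelPashkovich2011, Prop. 3, proof (arXiv p. 8: "the first condition of Theorem 1 is satisfied")] -/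
theorem flipSigns_singleton_mem_signing {P : Set (ι → ℝ)} (k : ι) {x : ι → ℝ} (hx : x ∈ signing P) :
    flipSigns {k} x ∈ signing P := by
  have himg : flipSigns {k} '' signing P =
      convexHull ℝ (flipSigns {k} '' ⋃ S : Finset ι, flipSigns S '' P) :=
    (flipLin {k}).image_convexHull (⋃ S : Finset ι, flipSigns S '' P)
  have hsub : flipSigns {k} '' (⋃ S : Finset ι, flipSigns S '' P) ⊆ ⋃ S : Finset ι, flipSigns S '' P := by
    rintro _ ⟨y, hy, rfl⟩
    obtain ⟨S, ⟨z, hz, rfl⟩⟩ := Set.mem_iUnion.1 hy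
    rw [flipSigns_singleton_flipSigns]
    exact Set.mem_iUnion.2 ⟨_, z, hz, rfl⟩
  have : flipSigns {k} x ∈ flipSigns {k} '' signing P := ⟨x, hx, rfl⟩
  rw [himg] at this
  exact convexHull_mono hsub this

/-- **KP11 Proposition 3**: if `P = conv V` with `|v| ∈ P` for every `v ∈ V`, the sequence
`(S₁, …, S_n)` maps `P` onto `sign(P)`. [cite: KaibelPashkovich2011, Prop. 3 (arXiv p. 8)] -/
theorem KaibelPashkovich2011_prop3 {P V : Set (ι → ℝ)} (hPV : P = convexHull ℝ V)
    (habs : ∀ v ∈ V, absVec v ∈ P) : seqImage (signSeq ι) P = signing P := by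
  apply KaibelPashkovich2011_thm1 (W := ⋃ S : Finset ι, flipSigns S '' V)
  · rw [hPV, signing_convexHull]
  · rw [hPV]; exact convex_convexHull ℝ V
  · intro x hx
    refine subset_convexHull ℝ _ (Set.mem_iUnion.2 ⟨∅, x, hx, flipSigns_empty x⟩)
  · intro h hh
    obtain ⟨k, -, rfl⟩ := List.mem_map.1 hh
    intro h0
    have := congrFun h0 k
    simp at this
  · intro h hh x hx
    obtain ⟨k, -, rfl⟩ := List.mem_map.1 hh
    dsimp only
    rw [reflectAt_neg_single]
    exact flipSigns_singleton_mem_signing k hx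
  · intro w hw
    obtain ⟨S, ⟨v, hv, rfl⟩⟩ := Set.mem_iUnion.1 hw
    rw [canonSeq_signSeq, absVec_flipSigns]
    exact habs v hv

/-- **KP11 Theorem 2**: under the hypotheses of Proposition 3, an EF of `P` with `r` inequalities
gives an EF of `sign(P)` with `r + 2n` inequalities (`n = |ι|`).
[cite: KaibelPashkovich2011, Thm. 2 (arXiv p. 8)] -/
theorem KaibelPashkovich2011_thm2 {P V : Set (ι → ℝ)} (hPV : P = convexHull ℝ V)
    (habs : ∀ v ∈ V, absVec v ∈ P) {r : ℕ} (h : HasEFOfSize P r) :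
    HasEFOfSize (signing P) (r + 2 * Fintype.card ι) := by
  have := h.seqImage (signSeq ι)
  rwa [KaibelPashkovich2011_prop3 hPV habs, length_signSeq] at this

end Signing

/-! ### §4.1.1: the reflection group `I₂(m)` and the regular `m`-gon -/

namespace RegularPolygon

open Real

/-! The regular `N`-gon of the tree (`RegularPolygonPsdLifts.lean`, Fawzi–Saunderson–Parrilo's
normalisation): vertices `vertex N i = (cos θ_i, sin θ_i)`, `θ_i = (2i+1)π/N`, `i : Fin N`, facet
description `polygon N`, and `polygon_eq_convexHull : polygon N = conv (range (vertex N))` (`N ≥ 3`).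
Kaibel–Pashkovich's picture (one vertex at `(1,0)`, mirrors `H_{kπ/m}`) is this one rotated by `−π/N`;
we work directly in the tree's normalisation: the mirrors become the lines at angles `(2^s + 1)π/N`
and the vertex `(1, 0)` becomes `vertex N 0` (angle `π/N`). -/

/-- The vertices of the regular `N`-gon indexed by an arbitrary INTEGER `j` (period `N`):
`(cos((2j+1)π/N), sin((2j+1)π/N))`; for `j < N` this is the tree's `vertex N j` (`vertexZ_natCast`).
[cite: KaibelPashkovich2011, §4.1.1 (arXiv p. 9)] -/
def vertexZ (N : ℕ) (j : ℤ) : Fin 2 → ℝ :=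
  ![Real.cos ((2 * j + 1) * π / N), Real.sin ((2 * j + 1) * π / N)]

/-- `vertexZ N i = vertex N i` for `i < N`. [cite: KaibelPashkovich2011, §4.1.1 (arXiv p. 9)] -/
theorem vertexZ_natCast {N : ℕ} (i : Fin N) : vertexZ N ((i : ℕ) : ℤ) = vertex N i := by
  simp [vertexZ, vertex, vertexAngle]

/-- The unit normal `(−sin φ, cos φ)` of the line `H_φ` through the origin at angle `φ`
("`H_φ = H^=((−sin φ, cos φ), 0)`"). [cite: KaibelPashkovich2011, §4.1.1 (arXiv p. 9)] -/
def lineNormal (φ : ℝ) : Fin 2 → ℝ := ![-Real.sin φ, Real.cos φ]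

/-- The angles `(2^s + 1)π/N` of the mirrors used in Proposition 4, in the tree's normalisation
(Kaibel–Pashkovich: `2^s π/m`, before the rotation by `π/N`). [cite: KaibelPashkovich2011, Prop. 4 (arXiv p. 9)] -/
def lineAngle (N s : ℕ) : ℝ := (2 ^ s + 1) * π / N

/-- The first `n` relations `(R_{H^≤_{π/m}}, R_{H^≤_{2π/m}}, …, R_{H^≤_{2^{n-1}π/m}})` of Proposition 4
(rotated; the proposition uses `n = ⌈log₂ m⌉ + 1`). [cite: KaibelPashkovich2011, Prop. 4 (arXiv p. 9)] -/
def mirrors (N n : ℕ) : List ((Fin 2 → ℝ) × ℝ) :=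
  (List.range n).map fun s => (lineNormal (lineAngle N s), (0 : ℝ))

/-- `mirrors N (n+1) = mirrors N n ++ [H_{(2^n+1)π/N}]`. [cite: KaibelPashkovich2011, Prop. 4 (arXiv p. 9)] -/
theorem mirrors_succ (N n : ℕ) :
    mirrors N (n + 1) = mirrors N n ++ [(lineNormal (lineAngle N n), (0 : ℝ))] := by
  simp [mirrors, List.range_succ]

/-- `mirrors N n` has length `n`. [cite: KaibelPashkovich2011, Thm. 3 (arXiv p. 9)] -/
@[simp] theorem length_mirrors (N n : ℕ) : (mirrors N n).length = n := by
  simp [mirrors]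

/-- `⟨(−sin φ, cos φ), (cos θ, sin θ)⟩ = sin(θ − φ)` (the halfspace `H^≤_φ` consists of the
directions with angle in `[φ − π, φ]`). [cite: KaibelPashkovich2011, §4.1.1 (arXiv p. 9)] -/
theorem lineNormal_dotProduct_circle (φ θ : ℝ) :
    lineNormal φ ⬝ᵥ ![Real.cos θ, Real.sin θ] = Real.sin (θ - φ) := by
  simp [lineNormal, dotProduct, Fin.sum_univ_two, Real.sin_sub]
  ring

/-- The normal `(−sin φ, cos φ)` of `H_φ` is a unit vector. [cite: KaibelPashkovich2011, §4.1.1 (arXiv p. 9)] -/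
theorem lineNormal_dotProduct_self (φ : ℝ) : lineNormal φ ⬝ᵥ lineNormal φ = 1 := by
  simp only [lineNormal, dotProduct, Fin.sum_univ_two, Matrix.cons_val_zero, Matrix.cons_val_one]
  nlinarith [Real.sin_sq_add_cos_sq φ]

/-- The normal of `H_φ` is nonzero (as §3 requires). [cite: KaibelPashkovich2011, §4.1.1 (arXiv p. 9)] -/
theorem lineNormal_ne_zero (φ : ℝ) : lineNormal φ ≠ 0 := by
  intro h
  have := lineNormal_dotProduct_self φ
  rw [h, dotProduct_zero] at this
  exact zero_ne_one this

/-- Reflecting the point at angle `θ` across the line at angle `φ` gives the point at angle `2φ − θ`.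
[cite: KaibelPashkovich2011, §4.1.1 (arXiv p. 9: "`I₂(m)` consists of the … reflections `ϱ_{H_{kπ/m}}`")] -/
theorem reflectAt_lineNormal_circle (φ θ : ℝ) :
    reflectAt (lineNormal φ) 0 ![Real.cos θ, Real.sin θ] =
      ![Real.cos (2 * φ - θ), Real.sin (2 * φ - θ)] := by
  obtain ⟨u, rfl⟩ : ∃ u, θ = u + φ := ⟨θ - φ, by ring⟩
  have e1 : u + φ - φ = u := by ring
  have e2 : 2 * φ - (u + φ) = φ - u := by ring
  rw [reflectAt, lineNormal_dotProduct_circle, lineNormal_dotProduct_self, e1, e2]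
  ext i
  fin_cases i
  · simp [lineNormal, Real.cos_add, Real.cos_sub]
    ring
  · simp [lineNormal, Real.sin_add, Real.sin_sub]
    ring

/-- `⟨lineNormal((2^s+1)π/N), vertexZ N j⟩ = sin(π(2j − 2^s)/N)`. [cite: KaibelPashkovich2011, Prop. 4, proof (arXiv p. 9)] -/
theorem lineNormal_dotProduct_vertexZ (N s : ℕ) (j : ℤ) :
    lineNormal (lineAngle N s) ⬝ᵥ vertexZ N j = Real.sin (π * ((2 * j - 2 ^ s : ℤ) : ℝ) / N) := by
  rw [vertexZ, lineNormal_dotProduct_circle, lineAngle]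
  congr 1
  push_cast
  ring

/-- The reflection at the `s`-th mirror maps vertex `j` to vertex `2^s − j`.
[cite: KaibelPashkovich2011, Prop. 4, proof (arXiv p. 9)] -/
theorem reflectAt_lineNormal_vertexZ (N s : ℕ) (j : ℤ) :
    reflectAt (lineNormal (lineAngle N s)) 0 (vertexZ N j) = vertexZ N (2 ^ s - j) := by
  have e : 2 * lineAngle N s - (2 * (j : ℝ) + 1) * π / N = (2 * ((2 ^ s - j : ℤ) : ℝ) + 1) * π / N := by
    push_cast
    unfold lineAngle
    ring
  simp only [vertexZ]
  rw [reflectAt_lineNormal_circle, e]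

/-- The vertices are `N`-periodic in `j`. [cite: KaibelPashkovich2011, §4.1.1 (arXiv p. 9)] -/
theorem vertexZ_add_mul {N : ℕ} (hN : N ≠ 0) (j n : ℤ) : vertexZ N (j + n * N) = vertexZ N j := by
  have hNR : (N : ℝ) ≠ 0 := by exact_mod_cast hN
  have hn : (n : ℝ) * N / N = n := mul_div_cancel_right₀ _ hNR
  have e : (2 * ((j + n * N : ℤ) : ℝ) + 1) * π / N = (2 * j + 1) * π / N + n * (2 * π) := by
    push_cast
    calc (2 * ((j : ℝ) + n * N) + 1) * π / N = (2 * j + 1) * π / N + 2 * π * (n * N / N) := by ring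
      _ = (2 * j + 1) * π / N + n * (2 * π) := by rw [hn]; ring
  simp only [vertexZ, e, Real.cos_add_int_mul_two_pi, Real.sin_add_int_mul_two_pi]

/-- Reduction of the vertex index modulo `N`. [cite: KaibelPashkovich2011, §4.1.1 (arXiv p. 9)] -/
theorem vertexZ_emod {N : ℕ} (hN : N ≠ 0) (k : ℤ) : vertexZ N (k % N) = vertexZ N k := by
  have e : k % (N : ℤ) = k + (-(k / N)) * N := by
    rw [Int.emod_def]
    ring
  rw [e, vertexZ_add_mul hN]

/-- Every `vertexZ N k` (`k ∈ ℤ`) is one of the `N` vertices `vertex N i`.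
[cite: KaibelPashkovich2011, §4.1.1 (arXiv p. 9)] -/
theorem vertexZ_mem_range {N : ℕ} (hN : N ≠ 0) (k : ℤ) : vertexZ N k ∈ Set.range (vertex N) := by
  have hN0 : (0 : ℤ) < N := by exact_mod_cast Nat.pos_of_ne_zero hN
  set r := k % (N : ℤ) with hr
  have h0 : 0 ≤ r := Int.emod_nonneg k hN0.ne'
  have h1 : r < N := Int.emod_lt_of_pos k hN0
  refine ⟨⟨r.toNat, by omega⟩, ?_⟩
  rw [← vertexZ_natCast]
  dsimp only
  rw [Int.toNat_of_nonneg h0]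
  exact vertexZ_emod hN k

/-- The mirrors map the regular `N`-gon `conv X_N` into itself (condition 1 of Theorem 1).
[cite: KaibelPashkovich2011, Prop. 4, proof (arXiv p. 9)] -/
theorem reflectAt_lineNormal_mem_convexHull {N : ℕ} (hN : N ≠ 0) (s : ℕ) {x : Fin 2 → ℝ}
    (hx : x ∈ convexHull ℝ (Set.range (vertex N))) :
    reflectAt (lineNormal (lineAngle N s)) 0 x ∈ convexHull ℝ (Set.range (vertex N)) := by
  set S := Set.range (vertex N) with hS
  have himg : reflectLin (lineNormal (lineAngle N s)) '' convexHull ℝ S =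
      convexHull ℝ (reflectLin (lineNormal (lineAngle N s)) '' S) :=
    (reflectLin (lineNormal (lineAngle N s))).image_convexHull S
  have hsub : reflectLin (lineNormal (lineAngle N s)) '' S ⊆ S := by
    rintro _ ⟨_, ⟨j, rfl⟩, rfl⟩
    rw [reflectLin_apply, ← vertexZ_natCast, reflectAt_lineNormal_vertexZ]
    exact vertexZ_mem_range hN _
  have : reflectAt (lineNormal (lineAngle N s)) 0 x ∈ reflectLin (lineNormal (lineAngle N s)) '' convexHull ℝ S :=
    ⟨x, hx, rfl⟩
  rw [himg] at this
  exact convexHull_mono hsub this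

/-! #### Signs of `sin(πt/N)` for integer `t` -/

/-- `sin(πt/m) ≤ 0` for `−m ≤ t ≤ 0`. [folklore] -/
private theorem sin_pi_mul_div_nonpos {m : ℕ} (hm : 0 < m) {t : ℤ} (h1 : -(m : ℤ) ≤ t) (h2 : t ≤ 0) :
    Real.sin (π * t / m) ≤ 0 := by
  have hmR : (0 : ℝ) < m := by exact_mod_cast hm
  have htR : (t : ℝ) ≤ 0 := by exact_mod_cast h2
  have htR' : -(m : ℝ) ≤ t := by exact_mod_cast h1
  have hpm : 0 < π / m := by positivity
  have e : π * t / m = π / m * t := by ring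
  rw [e]
  apply Real.sin_nonpos_of_nonpos_of_neg_pi_le (mul_nonpos_of_nonneg_of_nonpos hpm.le htR)
  calc -π = π / m * (-(m : ℝ)) := by field_simp
    _ ≤ π / m * t := mul_le_mul_of_nonneg_left htR' hpm.le

/-- `sin(πt/m) > 0` for `0 < t < m`. [folklore] -/
private theorem sin_pi_mul_div_pos {m : ℕ} (hm : 0 < m) {t : ℤ} (h1 : 0 < t) (h2 : t < m) :
    0 < Real.sin (π * t / m) := by
  have hmR : (0 : ℝ) < m := by exact_mod_cast hm
  have htR : (0 : ℝ) < t := by exact_mod_cast h1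
  have htR' : (t : ℝ) < m := by exact_mod_cast h2
  have hpm : 0 < π / m := by positivity
  have e : π * t / m = π / m * t := by ring
  rw [e]
  apply Real.sin_pos_of_pos_of_lt_pi (mul_pos hpm htR)
  calc π / m * t < π / m * m := mul_lt_mul_of_pos_left htR' hpm
    _ = π := by field_simp

/-- `sin(πt/m) > 0` for `−2m < t < −m` (periodicity). [folklore] -/
private theorem sin_pi_mul_div_pos_of_lt_neg {m : ℕ} (hm : 0 < m) {t : ℤ} (h1 : -(2 * (m : ℤ)) < t)
    (h2 : t < -(m : ℤ)) : 0 < Real.sin (π * t / m) := by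
  have hmR : (0 : ℝ) < m := by exact_mod_cast hm
  have htR : -(2 * (m : ℝ)) < t := by exact_mod_cast h1
  have htR' : (t : ℝ) < -(m : ℝ) := by exact_mod_cast h2
  have hpm : 0 < π / m := by positivity
  rw [← Real.sin_add_two_pi]
  have e : π * t / m + 2 * π = π / m * (t + 2 * m) := by field_simp
  rw [e]
  apply Real.sin_pos_of_pos_of_lt_pi (mul_pos hpm (by linarith))
  calc π / m * (t + 2 * m) < π / m * m := mul_lt_mul_of_pos_left (by linarith) hpm
    _ = π := by field_simp

/-! #### The canonical preimages of the vertices (condition 2 of Theorem 1) -/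

/-- `2^⌈log₂ m⌉ < 2m` for `m ≥ 1`. [folklore] -/
private theorem two_pow_clog_lt_two_mul {m : ℕ} (hm : 1 ≤ m) : 2 ^ Nat.clog 2 m < 2 * m := by
  rcases eq_or_lt_of_le hm with h1 | h1
  · subst h1; simp
  · have h := Nat.pow_pred_clog_lt_self one_lt_two h1
    have hc : 1 ≤ Nat.clog 2 m := Nat.clog_pos one_lt_two h1
    obtain ⟨c, hc'⟩ : ∃ c, Nat.clog 2 m = c + 1 := Nat.exists_eq_succ_of_ne_zero (by omega)
    rw [hc', Nat.pred_succ] at h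
    rw [hc', pow_succ]
    omega

/-- First step (`s = r = ⌈log₂ N⌉`): the conditional reflection at the `r`-th mirror sends every
vertex `j ∈ [0, N)` to a vertex `j'` with `0 ≤ 2j' ≤ 2^r`. [cite: KaibelPashkovich2011, Prop. 4, proof (arXiv p. 9)] -/
theorem canon_vertexZ_top {N : ℕ} (hN : 1 ≤ N) (j : ℤ) (hj0 : 0 ≤ j) (hjN : j < N) :
    ∃ j' : ℤ, canon (lineNormal (lineAngle N (Nat.clog 2 N))) 0 (vertexZ N j) = vertexZ N j' ∧
      0 ≤ j' ∧ 2 * j' ≤ 2 ^ Nat.clog 2 N := by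
  have hN0 : 0 < N := hN
  have hNr : (N : ℤ) ≤ 2 ^ Nat.clog 2 N := by exact_mod_cast Nat.le_pow_clog one_lt_two N
  have h2r : (2 : ℤ) ^ Nat.clog 2 N < 2 * N := by exact_mod_cast two_pow_clog_lt_two_mul hN
  by_cases hle : lineNormal (lineAngle N (Nat.clog 2 N)) ⬝ᵥ vertexZ N j ≤ 0
  · -- `t = 2j − 2^r ≤ 0`, else `0 < t < N` and the sine is positive
    rw [canon, if_pos hle]
    rw [lineNormal_dotProduct_vertexZ] at hle
    refine ⟨j, rfl, hj0, ?_⟩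
    by_contra hlt
    exact absurd hle (not_le.2
      (sin_pi_mul_div_pos hN0 (t := 2 * j - 2 ^ Nat.clog 2 N) (by omega) (by omega)))
  · rw [canon, if_neg hle, reflectAt_lineNormal_vertexZ]
    rw [lineNormal_dotProduct_vertexZ] at hle
    have hlt := not_le.1 hle
    -- `t ∉ [−N, 0]`
    have ht : ¬ (-(N : ℤ) ≤ 2 * j - 2 ^ Nat.clog 2 N ∧ 2 * j - 2 ^ Nat.clog 2 N ≤ 0) := by
      rintro ⟨h1, h2⟩
      exact absurd (sin_pi_mul_div_nonpos hN0 h1 h2) (not_le.2 hlt)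
    rw [not_and_or, not_le, not_le] at ht
    rcases ht with ht | ht
    · -- `t < −N`: reduce the index by `N`
      refine ⟨2 ^ Nat.clog 2 N - j - N, ?_, by omega, by omega⟩
      have := vertexZ_add_mul (N := N) (by omega) (2 ^ Nat.clog 2 N - j - N) 1
      rw [one_mul, show (2 : ℤ) ^ Nat.clog 2 N - j - N + N = 2 ^ Nat.clog 2 N - j by ring] at this
      exact this
    · exact ⟨2 ^ Nat.clog 2 N - j, rfl, by omega, by omega⟩

/-- Later steps (`s < r`): the conditional reflection at the `s`-th mirror sends a vertex `j` with
`0 ≤ 2j ≤ 2^{s+1}` to a vertex `j'` with `0 ≤ 2j' ≤ 2^s`. [cite: KaibelPashkovich2011, Prop. 4, proof (arXiv p. 9)] -/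
theorem canon_vertexZ_step {N : ℕ} (hN : 1 ≤ N) (s : ℕ) (hs : s < Nat.clog 2 N) (j : ℤ) (hj0 : 0 ≤ j)
    (hj : 2 * j ≤ 2 ^ (s + 1)) :
    ∃ j' : ℤ, canon (lineNormal (lineAngle N s)) 0 (vertexZ N j) = vertexZ N j' ∧ 0 ≤ j' ∧
      2 * j' ≤ 2 ^ s := by
  have hN0 : 0 < N := hN
  have h2r : (2 : ℤ) ^ Nat.clog 2 N < 2 * N := by exact_mod_cast two_pow_clog_lt_two_mul hN
  have hpow : (2 : ℤ) ^ (s + 1) ≤ 2 ^ Nat.clog 2 N := pow_le_pow_right₀ (by norm_num) hs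
  have e : (2 : ℤ) ^ (s + 1) = 2 * 2 ^ s := by ring
  have hsN : (2 : ℤ) ^ s < N := by omega
  by_cases hle : lineNormal (lineAngle N s) ⬝ᵥ vertexZ N j ≤ 0
  · rw [canon, if_pos hle]
    rw [lineNormal_dotProduct_vertexZ] at hle
    refine ⟨j, rfl, hj0, ?_⟩
    by_contra hlt
    exact absurd hle (not_le.2 (sin_pi_mul_div_pos hN0 (t := 2 * j - 2 ^ s) (by omega) (by omega)))
  · rw [canon, if_neg hle, reflectAt_lineNormal_vertexZ]
    rw [lineNormal_dotProduct_vertexZ] at hle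
    have hlt := not_le.1 hle
    refine ⟨2 ^ s - j, rfl, by omega, ?_⟩
    by_contra hgt
    exact absurd (sin_pi_mul_div_nonpos hN0 (t := 2 * j - 2 ^ s) (by omega) (by omega))
      (not_le.2 hlt)

/-- The first `n ≤ ⌈log₂ N⌉` canonical preimages take every vertex `j` with `0 ≤ 2j ≤ 2^n` to the
vertex `0`. [cite: KaibelPashkovich2011, Prop. 4, proof (arXiv p. 9)] -/
theorem canonSeq_mirrors_vertexZ_of_le {N : ℕ} (hN : 1 ≤ N) :
    ∀ n : ℕ, n ≤ Nat.clog 2 N → ∀ j : ℤ, 0 ≤ j → 2 * j ≤ 2 ^ n →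
      canonSeq (mirrors N n) (vertexZ N j) = vertexZ N 0
  | 0, _, j, hj0, hj => by
    have : j = 0 := by
      rw [pow_zero] at hj
      omega
    subst this
    simp [mirrors, canonSeq]
  | n + 1, hn, j, hj0, hj => by
    rw [mirrors_succ, canonSeq_append_singleton]
    obtain ⟨j', hj', h0', hle'⟩ := canon_vertexZ_step hN n (by omega) j hj0 hj
    dsimp only
    rw [hj']
    exact canonSeq_mirrors_vertexZ_of_le hN n (by omega) j' h0' hle'

/-- **Condition 2 of Theorem 1 for Proposition 4 with `P` = one vertex**:
`ϱ*_{H₁^≤} ∘ ⋯ ∘ ϱ*_{H_{r+1}^≤}(w) = vertex 0` for every vertex `w` of the regular `N`-gon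
("Observing that [it] is contained in `Φ_{I₂(m)}`, we conclude that it equals `v_Φ ∈ P`").
[cite: KaibelPashkovich2011, Prop. 4, proof (arXiv p. 9)] -/
theorem canonSeq_mirrors_vertexZ {N : ℕ} (hN : 1 ≤ N) (j : ℤ) (hj0 : 0 ≤ j) (hjN : j < N) :
    canonSeq (mirrors N (Nat.clog 2 N + 1)) (vertexZ N j) = vertexZ N 0 := by
  rw [mirrors_succ, canonSeq_append_singleton]
  obtain ⟨j', hj', h0', hle'⟩ := canon_vertexZ_top hN j hj0 hjN
  dsimp only
  rw [hj']
  exact canonSeq_mirrors_vertexZ_of_le hN _ le_rfl j' h0' hle'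

/-- **KP11 Proposition 4 for `P` = one vertex**: the sequence of `⌈log₂ N⌉ + 1` reflection relations
maps the single vertex `vertex N 0` onto the regular `N`-gon, `𝓡({x_0}) = Π_{I₂(N)}({x_0}) = conv X_N`.
[cite: KaibelPashkovich2011, Prop. 4 (arXiv p. 9)] -/
theorem seqImage_mirrors_singleton {N : ℕ} (hN : 1 ≤ N) :
    seqImage (mirrors N (Nat.clog 2 N + 1)) {vertexZ N 0} = convexHull ℝ (Set.range (vertex N)) := by
  have hN0 : N ≠ 0 := by omega
  apply KaibelPashkovich2011_thm1 (W := Set.range (vertex N)) rfl (convex_singleton _)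
  · rintro _ rfl
    refine subset_convexHull ℝ _ ⟨⟨0, hN⟩, ?_⟩
    rw [← vertexZ_natCast]
    simp
  · intro h hh
    obtain ⟨s, -, rfl⟩ := List.mem_map.1 hh
    exact lineNormal_ne_zero _
  · intro h hh x hx
    obtain ⟨s, -, rfl⟩ := List.mem_map.1 hh
    exact reflectAt_lineNormal_mem_convexHull hN0 s hx
  · rintro _ ⟨j, rfl⟩
    rw [Set.mem_singleton_iff, ← vertexZ_natCast]
    exact canonSeq_mirrors_vertexZ hN j (by positivity) (by exact_mod_cast j.2)

/-- **KP11 Theorem 3 for `P` = one vertex / Ben-Tal–Nemirovski: the regular `N`-gon `conv X_N` has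
an extended formulation with `2⌈log₂ N⌉ + 2` inequalities** ("we obtain an extended formulation of a
regular `m`-gon with `⌈log(m)⌉ + 1` variables and `2⌈log(m)⌉ + 2` inequalities by choosing
`P = {(1,0)}` …, thus reproving a result due to Ben-Tal and Nemirovski"), for every `N ≥ 1`.
[cite: KaibelPashkovich2011, Thm. 3 (arXiv p. 9)] [cite: BenTalNemirovski2001, §2] -/
theorem hasEFOfSize_convexHull_vertex {N : ℕ} (hN : 1 ≤ N) :
    HasEFOfSize (convexHull ℝ (Set.range (vertex N))) (2 * Nat.clog 2 N + 2) := by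
  have h0 : HasEFOfSize ({vertexZ N 0} : Set (Fin 2 → ℝ)) 0 := hasEFOfSize_singleton _
  have h := h0.seqImage (mirrors N (Nat.clog 2 N + 1))
  rw [seqImage_mirrors_singleton hN, length_mirrors] at h
  rw [show 2 * Nat.clog 2 N + 2 = 0 + 2 * (Nat.clog 2 N + 1) by ring]
  exact h

/-- The same for the tree's facet description `RegularPolygon.polygon N` (`N ≥ 3`, where
`polygon N = conv X_N`): **`xc(regular N-gon) ≤ 2⌈log₂ N⌉ + 2`** — to be compared with the psd lift of
size `2 log₂ N − 1` of `RegularPolygon.hasPsdLift_polygon` (Fawzi–Saunderson–Parrilo) and the lower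
bound `log₂ N` below. [cite: KaibelPashkovich2011, Thm. 3 (arXiv p. 9)] [cite: BenTalNemirovski2001, §2] -/
theorem hasEFOfSize_polygon {N : ℕ} (hN : 3 ≤ N) : HasEFOfSize (polygon N) (2 * Nat.clog 2 N + 2) := by
  haveI : NeZero N := ⟨by omega⟩
  rw [polygon_eq_convexHull hN]
  exact hasEFOfSize_convexHull_vertex (by omega)

/-! #### The matching lower bound `log₂ N ≤ xc` (Goemans' face counting) -/

/-- `⟨vertexZ N j, vertexZ N k⟩ = cos((2j+1)π/N − (2k+1)π/N)` (vertices on the unit circle).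
[cite: KaibelPashkovich2011, §4.1.1 (arXiv p. 9)] -/
theorem vertexZ_dotProduct_vertexZ (N : ℕ) (j k : ℤ) :
    vertexZ N j ⬝ᵥ vertexZ N k = Real.cos ((2 * j + 1) * π / N - (2 * k + 1) * π / N) := by
  simp [vertexZ, dotProduct, Fin.sum_univ_two, Real.cos_sub]

/-- Distinct vertices `j ≠ k` in `[0, N)` of the regular `N`-gon make an angle with cosine `< 1`
(so the `N` listed vertices are pairwise distinct). [cite: KaibelPashkovich2011, §4.1.1 (arXiv p. 9)] -/
theorem cos_vertexAngle_sub_lt_one {N : ℕ} (hN : 0 < N) {j k : ℤ} (hj : 0 ≤ j) (hjN : j < N)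
    (hk : 0 ≤ k) (hkN : k < N) (hne : j ≠ k) :
    Real.cos ((2 * j + 1) * π / N - (2 * k + 1) * π / N) < 1 := by
  refine lt_of_le_of_ne (Real.cos_le_one _) fun h => ?_
  obtain ⟨n, hn⟩ := (Real.cos_eq_one_iff _).1 h
  have hNR : (N : ℝ) ≠ 0 := by positivity
  have h2 : ((n * N : ℤ) : ℝ) = ((j - k : ℤ) : ℝ) := by
    have hπ : (2 * π : ℝ) ≠ 0 := by positivity
    apply mul_right_cancel₀ hπ
    push_cast
    calc (n : ℝ) * N * (2 * π) = N * (n * (2 * π)) := by ring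
      _ = N * ((2 * j + 1) * π / N - (2 * k + 1) * π / N) := by rw [hn]
      _ = (j - k) * (2 * π) := by field_simp; ring
  have h3 : n * (N : ℤ) = j - k := by exact_mod_cast h2
  rcases lt_trichotomy n 0 with hn0 | hn0 | hn0
  · have : n * (N : ℤ) ≤ -1 * N := Int.mul_le_mul_of_nonneg_right (by omega) (by omega)
    linarith
  · subst hn0
    rw [zero_mul] at h3
    omega
  · have : 1 * (N : ℤ) ≤ n * N := Int.mul_le_mul_of_nonneg_right (by omega) (by omega)
    linarith

/-- Every vertex is an extreme point of the regular `N`-gon `conv X_N` (it is the unique maximiser of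
`⟨vertex N j, ·⟩`). [cite: Goemans2015, §2 ("`v(P)` vertices")] -/
theorem vertex_mem_extremePoints {N : ℕ} (hN : 0 < N) (j : Fin N) :
    vertex N j ∈ (convexHull ℝ (Set.range (vertex N))).extremePoints ℝ := by
  refine mem_extremePoints_convexHull_of_dotProduct_lt (c := vertex N j) ⟨j, rfl⟩ ?_
  rintro _ ⟨k, rfl⟩ hne
  rw [← vertexZ_natCast, ← vertexZ_natCast, vertexZ_dotProduct_vertexZ, vertexZ_dotProduct_vertexZ,
    sub_self, Real.cos_zero]
  refine cos_vertexAngle_sub_lt_one hN (by positivity) (by exact_mod_cast j.2) (by positivity)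
    (by exact_mod_cast k.2) fun h => hne ?_
  have : k = j := Fin.ext (by exact_mod_cast h.symm)
  rw [this]

/-- **Lower bound (Goemans 2015 Thm. 1 applied to the `N`-gon): every extended formulation of the
regular `N`-gon with `r` inequalities has `N ≤ 2^r`**, i.e. `xc ≥ log₂ N`; with
`hasEFOfSize_convexHull_vertex` the extension complexity of the regular `N`-gon is `Θ(log N)`.
[cite: Goemans2015, Thm. 1 (§2)]
[cite: KaibelPashkovich2011, §1 (arXiv p. 4: "extended formulations with `2⌈log(m)⌉ + 2` inequalities for regular `m`-gons")] -/
theorem le_two_pow_of_hasEFOfSize {N : ℕ} (hN : 0 < N) {r : ℕ}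
    (h : HasEFOfSize (convexHull ℝ (Set.range (vertex N))) r) : N ≤ 2 ^ r := by
  classical
  haveI : Finite ((convexHull ℝ (Set.range (vertex N))).extremePoints ℝ) :=
    h.finite_extremePoints.to_subtype
  let f : Fin N → (convexHull ℝ (Set.range (vertex N))).extremePoints ℝ :=
    fun j => ⟨vertex N j, vertex_mem_extremePoints hN j⟩
  have hf : Function.Injective f := by
    intro j k hjk
    by_contra hne
    have hv : vertex N j = vertex N k := congrArg Subtype.val hjk
    have hlt := cos_vertexAngle_sub_lt_one hN (j := ((j : ℕ) : ℤ)) (k := ((k : ℕ) : ℤ))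
      (by positivity) (by exact_mod_cast j.2) (by positivity) (by exact_mod_cast k.2)
      (fun h => hne (Fin.ext (by exact_mod_cast h)))
    rw [← vertexZ_dotProduct_vertexZ, vertexZ_natCast, vertexZ_natCast, hv, ← vertexZ_natCast,
      vertexZ_dotProduct_vertexZ, sub_self, Real.cos_zero] at hlt
    exact lt_irrefl _ hlt
  calc N = Nat.card (Fin N) := by simp
    _ ≤ Nat.card ((convexHull ℝ (Set.range (vertex N))).extremePoints ℝ) :=
        Nat.card_le_card_of_injective f hf
    _ ≤ 2 ^ r := h.natCard_extremePoints_le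

/-- Lower bound for the tree's `polygon N` (`N ≥ 3`): `N ≤ 2^r` for every EF with `r` inequalities.
[cite: Goemans2015, Thm. 1 (§2)] -/
theorem le_two_pow_of_hasEFOfSize_polygon {N : ℕ} (hN : 3 ≤ N) {r : ℕ}
    (h : HasEFOfSize (polygon N) r) : N ≤ 2 ^ r := by
  haveI : NeZero N := ⟨by omega⟩
  rw [polygon_eq_convexHull hN] at h
  exact le_two_pow_of_hasEFOfSize (by omega) h

/-- Logarithmic form: `log₂ N ≤ r` for every EF of the regular `N`-gon (`N ≥ 3`) with `r`
inequalities. [cite: Goemans2015, Thm. 1 (§2)] -/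
theorem logb_le_of_hasEFOfSize_polygon {N : ℕ} (hN : 3 ≤ N) {r : ℕ} (h : HasEFOfSize (polygon N) r) :
    Real.logb 2 N ≤ r := by
  have hle : (N : ℝ) ≤ (2 : ℝ) ^ (r : ℝ) := by
    rw [Real.rpow_natCast]
    exact_mod_cast le_two_pow_of_hasEFOfSize_polygon hN h
  exact (Real.logb_le_iff_le_rpow one_lt_two (by exact_mod_cast (show 0 < N by omega))).2 hle

end RegularPolygon

/-! ### §4.1.3 (appended): the cube, the cross-polytope and the `B_n`-permutahedron of a point

Kaibel–Pashkovich, §4.1.3 (arXiv p. 10), verbatim: "The group `B_n` is generated by the reflections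
in `ℝⁿ` at the hyperplanes `H^=(e_k + e_ℓ, 0)`, `H^=(e_k − e_ℓ, 0)` and `H^=(e_k, 0)` … It is the
symmetry group of both the `n`-dimensional cube `conv{−1,+1}ⁿ` and the `n`-dimensional cross-polytope
`conv{±e_1, …, ±e_n}`. … The orbit of a point `x ∈ ℝⁿ` under the action of `B_n` consists of all
points which can be obtained from `x` by permuting its coordinates and changing the signs of some
subset of its coordinates. … **Proposition 6.** Let `𝓡` be induced by a sequence
`(T_{k_1 ℓ_1}, …, T_{k_r ℓ_r}, S_1, …, S_n)` of reflection relations, where `(k_1,ℓ_1), …, (k_r,ℓ_r)`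
is a sorting network … then `𝓡(P) = Π_{B_n}(P)`. … **Theorem 5.** For each polytope `P ⊆ ℝⁿ` with
`v^{sort-abs} ∈ P` for each vertex `v` of `P` that admits an extended formulation with `n'` variables
and `f'` inequalities, there is an extended formulation of `Π_{B_n}(P)` with `n' + O(n log n)`
variables and `f' + O(n log n)` inequalities." Here: Theorem 2 applied to the three polytopes named —
the cube is the signing of the point `𝟙`, the cross-polytope is the signing of the standard simplex,
and `Π_{B_n}` of the point `(1, 2, …, n)` is the signing of the permutahedron, whose sorting-network
formulation is the tree's `ComparatorNetwork.hasEFOfSize_permutahedron_nlogsq` (Goemans / Batcher,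
`O(n log² n)` unconditionally; `O(n log n)` would need AKS). -/

section Bn

variable {n : ℕ}

/-- The signing of the point `𝟙 = (1, …, 1)` is the cube `conv{−1,+1}ⁿ`.
[cite: KaibelPashkovich2011, §4.1.3 (arXiv p. 10)] -/
theorem signing_one_eq_cube :
    signing ({fun _ => (1 : ℝ)} : Set (Fin n → ℝ)) =
      convexHull ℝ {x : Fin n → ℝ | ∀ i, x i = 1 ∨ x i = -1} := by
  rw [← convexHull_singleton (𝕜 := ℝ) (fun _ : Fin n => (1 : ℝ)), signing_convexHull]
  congr 1
  ext x
  simp only [Set.mem_iUnion, Set.mem_image, Set.mem_singleton_iff, Set.mem_setOf_eq]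
  constructor
  · rintro ⟨S, y, rfl, rfl⟩ i
    by_cases hi : i ∈ S <;> simp [flipSigns, hi]
  · intro hx
    refine ⟨Finset.univ.filter fun i => x i = -1, fun _ => 1, rfl, ?_⟩
    funext i
    rcases hx i with h | h
    · have h1 : ¬ ((1 : ℝ) = -1) := by norm_num
      simp [flipSigns, h, h1]
    · simp [flipSigns, h]

/-- **The cube `[−1, 1]ⁿ = conv{−1,+1}ⁿ` has an extended formulation with `2n` inequalities**
(Theorem 2 with `P` = the point `𝟙`, `f' = 0`). [cite: KaibelPashkovich2011, Thm. 2 and §4.1.3 (arXiv pp. 8, 10)] -/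
theorem hasEFOfSize_cube :
    HasEFOfSize (convexHull ℝ {x : Fin n → ℝ | ∀ i, x i = 1 ∨ x i = -1}) (2 * n) := by
  have h := KaibelPashkovich2011_thm2 (P := ({fun _ => (1 : ℝ)} : Set (Fin n → ℝ)))
    (V := {fun _ => (1 : ℝ)}) (convexHull_singleton (𝕜 := ℝ) _).symm
    (fun v hv => by
      rw [Set.mem_singleton_iff] at hv
      subst hv
      show absVec (fun _ : Fin n => (1 : ℝ)) ∈ ({fun _ => (1 : ℝ)} : Set (Fin n → ℝ))
      rw [Set.mem_singleton_iff]
      funext i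
      simp [absVec])
    (hasEFOfSize_singleton _)
  rw [signing_one_eq_cube, Fintype.card_fin, zero_add] at h
  exact h

/-- The standard simplex `{x ≥ 0, Σ x = 1} ⊆ ℝⁿ` has a slack-form EF with `n` inequalities
(`x − y = 0`, `Σ y = 1`, `y ≥ 0`). [cite: KaibelPashkovich2011, Remark 1 (arXiv p. 5)] -/
theorem hasEFOfSize_stdSimplex (n : ℕ) : HasEFOfSize (stdSimplex ℝ (Fin n)) n := by
  classical
  have h0 := hasEFOfSize_of_system (ι := Fin n)
    (Matrix.fromRows (1 : Matrix (Fin n) (Fin n) ℝ) (0 : Matrix Unit (Fin n) ℝ))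
    (Matrix.fromRows (-1 : Matrix (Fin n) (Fin n) ℝ) (Matrix.of fun (_ : Unit) _ => (1 : ℝ)))
    (Sum.elim 0 fun _ => 1)
  rw [Fintype.card_fin] at h0
  convert h0 using 1
  ext x
  have hsum : ∀ y : Fin n → ℝ, (Matrix.of fun (_ : Unit) (_ : Fin n) => (1 : ℝ)) *ᵥ y =
      fun _ => ∑ j, y j := by
    intro y
    funext u
    simp [Matrix.mulVec, dotProduct]
  simp only [stdSimplex, Set.mem_setOf_eq, Matrix.fromRows_mulVec, Matrix.one_mulVec,
    Matrix.zero_mulVec, Matrix.neg_mulVec, hsum, sumElim_add_sumElim_eq_sumElim_iff, zero_add,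
    add_neg_eq_zero]
  constructor
  · rintro ⟨hx0, hx1⟩
    exact ⟨x, hx0, rfl, funext fun _ => hx1⟩
  · rintro ⟨y, hy, rfl, hsum1⟩
    exact ⟨hy, congrFun hsum1 ()⟩

/-- The signing of the standard simplex is the cross-polytope `conv{±e_1, …, ±e_n}`.
[cite: KaibelPashkovich2011, §4.1.3 (arXiv p. 10)] -/
theorem signing_stdSimplex_eq_crossPolytope :
    signing (stdSimplex ℝ (Fin n)) =
      convexHull ℝ {x : Fin n → ℝ | ∃ (i : Fin n) (s : ℝ), (s = 1 ∨ s = -1) ∧ x = Pi.single i s} := by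
  classical
  rw [← convexHull_basis_eq_stdSimplex, signing_convexHull]
  congr 1
  ext x
  simp only [Set.mem_iUnion, Set.mem_image, Set.mem_range, Set.mem_setOf_eq]
  constructor
  · rintro ⟨S, _, ⟨i, rfl⟩, rfl⟩
    refine ⟨i, if i ∈ S then -1 else 1, by by_cases hi : i ∈ S <;> simp [hi], ?_⟩
    funext j
    by_cases hij : i = j
    · subst hij
      by_cases hi : i ∈ S <;> simp [flipSigns, hi]
    · have hji : j ≠ i := fun h => hij h.symm
      by_cases hj : j ∈ S <;> simp [flipSigns, hj, hij, hji]
  · rintro ⟨i, s, hs, rfl⟩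
    refine ⟨if s = 1 then ∅ else {i}, fun j => if i = j then 1 else 0, ⟨i, rfl⟩, ?_⟩
    funext j
    rcases hs with rfl | rfl
    · by_cases hij : i = j
      · subst hij; simp [flipSigns]
      · have hji : j ≠ i := fun h => hij h.symm
        simp [flipSigns, hij, hji]
    · have hne : (-1 : ℝ) ≠ 1 := by norm_num
      by_cases hij : i = j
      · subst hij; simp [flipSigns, hne]
      · have hji : j ≠ i := fun h => hij h.symm
        simp [flipSigns, hij, hji, hne]

/-- **The cross-polytope `conv{±e_1, …, ±e_n}` has an extended formulation with `3n` inequalities**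
(Theorem 2 with `P` = the standard simplex, `f' = n`). [cite: KaibelPashkovich2011, Thm. 2 and §4.1.3 (arXiv pp. 8, 10)] -/
theorem hasEFOfSize_crossPolytope :
    HasEFOfSize (convexHull ℝ {x : Fin n → ℝ | ∃ (i : Fin n) (s : ℝ), (s = 1 ∨ s = -1) ∧ x = Pi.single i s})
      (n + 2 * n) := by
  classical
  have h := KaibelPashkovich2011_thm2 (P := stdSimplex ℝ (Fin n))
    (V := Set.range fun i j : Fin n => if i = j then (1 : ℝ) else 0) (convexHull_basis_eq_stdSimplex _ _).symm
    (fun v hv => by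
      obtain ⟨i, rfl⟩ := hv
      have : absVec (fun j : Fin n => if i = j then (1 : ℝ) else 0) = fun j => if i = j then 1 else 0 := by
        funext j
        by_cases hij : i = j <;> simp [absVec, hij]
      rw [this]
      exact ite_eq_mem_stdSimplex ℝ i)
    (hasEFOfSize_stdSimplex n)
  rw [signing_stdSimplex_eq_crossPolytope, Fintype.card_fin] at h
  exact h

/-- **KP11 Theorem 5 for `P` = the point `(1, 2, …, n)`: the `B_n`-permutahedron** `conv{(±σ(1), …,
±σ(n))}` — the signing of the permutahedron — **has an extended formulation with
`2n(⌈log₂ n⌉² + 4) + 2n` inequalities** (Theorem 2 on top of the sorting-network formulation of the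
permutahedron in the tree; with an `O(n log n)` sorting network this is the printed `f' + O(n log n)`).
[cite: KaibelPashkovich2011, Thm. 5 (arXiv p. 10)] -/
theorem KaibelPashkovich2011_thm5_point (hn : 1 ≤ n) :
    HasEFOfSize (signing (permutahedron n)) (2 * n * (Nat.clog 2 n * Nat.clog 2 n + 4) + 2 * n) := by
  have h := KaibelPashkovich2011_thm2 (P := permutahedron n) (V := Set.range (permVec (n := n))) rfl
    (fun v hv => by
      obtain ⟨σ, rfl⟩ := hv
      have : absVec (permVec σ) = permVec σ := by
        funext i
        simp only [absVec, permVec]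
        exact abs_of_nonneg (by positivity)
      rw [this]
      exact subset_convexHull ℝ _ ⟨σ, rfl⟩)
    (ComparatorNetwork.hasEFOfSize_permutahedron_nlogsq hn)
  rw [Fintype.card_fin] at h
  exact h

/-- The `B_n`-permutahedron of `(1, …, n)` is the convex hull of all signed permutations
`(ε_1 σ(1), …, ε_n σ(n))` ("permuting its coordinates and changing the signs of some subset of its
coordinates"). [cite: KaibelPashkovich2011, §4.1.3 (arXiv p. 10)] -/
theorem signing_permutahedron_eq :
    signing (permutahedron n) =
      convexHull ℝ (⋃ S : Finset (Fin n), Set.range fun σ : Equiv.Perm (Fin n) => flipSigns S (permVec σ)) := by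
  rw [permutahedron, signing_convexHull]
  congr 1
  ext x
  simp only [Set.mem_iUnion, Set.mem_image, Set.mem_range]
  constructor
  · rintro ⟨S, _, ⟨σ, rfl⟩, rfl⟩
    exact ⟨S, σ, rfl⟩
  · rintro ⟨S, σ, rfl⟩
    exact ⟨S, _, ⟨σ, rfl⟩, rfl⟩

end Bn

/-! ### §4.1.2: the reflection group `A_{n−1}` — transposition relations, sorting networks
(Proposition 5, Theorem 4), and §4.1.3 Proposition 6 / Theorem 5 for a general polytope -/

section An

variable {n : ℕ}

/-- Images of `conv V` under a family of linear maps generate the same convex hull as the images of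
`V` ("`Q = conv(W)` with `W = {γ.v : γ ∈ G, v vertex of P}`").
[cite: KaibelPashkovich2011, Prop. 5, proof (arXiv p. 10)] -/
theorem convexHull_iUnion_image_convexHull {E : Type*} [AddCommGroup E] [Module ℝ E] {κ : Type*}
    (f : κ → E →ₗ[ℝ] E) (V : Set E) :
    convexHull ℝ (⋃ k, (f k : E → E) '' convexHull ℝ V) = convexHull ℝ (⋃ k, (f k : E → E) '' V) := by
  apply Set.Subset.antisymm
  · refine convexHull_min ?_ (convex_convexHull ℝ _)
    intro y hy
    obtain ⟨k, hyk⟩ := Set.mem_iUnion.1 hy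
    rw [(f k).image_convexHull V] at hyk
    exact convexHull_mono (Set.subset_iUnion (fun k => (f k : E → E) '' V) k) hyk
  · exact convexHull_mono (Set.iUnion_mono fun k => Set.image_mono (subset_convexHull ℝ V))

/-- `γ.x` for `γ ∈ 𝔖(n)` is "the vector obtained from `x ∈ ℝⁿ` by permuting the coordinates according
to `γ`" (here: `x ∘ σ`), and the **`A_{n−1}`-permutahedron of `P`** is
`Π_{A_{n−1}}(P) = conv ⋃_{γ ∈ 𝔖(n)} γ.P`. [cite: KaibelPashkovich2011, §4.1.2 (arXiv pp. 9–10)] -/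
def permHull (P : Set (Fin n → ℝ)) : Set (Fin n → ℝ) :=
  convexHull ℝ (⋃ σ : Equiv.Perm (Fin n), (fun x : Fin n → ℝ => x ∘ ⇑σ) '' P)

/-- `sort(y)`: "the vector that is obtained from `y` by sorting the components in non-decreasing
order" (`= Φ(y)` for the fundamental domain `x₁ ≤ ⋯ ≤ x_n`). [cite: KaibelPashkovich2011, §4.1.2 (arXiv p. 10)] -/
def sortVec (y : Fin n → ℝ) : Fin n → ℝ := y ∘ ⇑(Tuple.sort y)

/-- `sort(y)` is non-decreasing. [cite: KaibelPashkovich2011, §4.1.2 (arXiv p. 10)] -/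
theorem monotone_sortVec (y : Fin n → ℝ) : Monotone (sortVec y) := Tuple.monotone_sort y

/-- `sort(γ.y) = sort(y)` ("`sort(w) = sort(v)`" for `w = γ.v`). [cite: KaibelPashkovich2011, Prop. 5, proof (arXiv p. 10)] -/
theorem sortVec_comp_perm (y : Fin n → ℝ) (σ : Equiv.Perm (Fin n)) : sortVec (y ∘ ⇑σ) = sortVec y :=
  Tuple.comp_perm_comp_sort_eq_comp_sort

/-- A non-decreasing rearrangement of `y` is `sort(y)`. [cite: KaibelPashkovich2011, §4.1.2 (arXiv p. 10)] -/
theorem comp_eq_sortVec_of_monotone {y : Fin n → ℝ} {τ : Equiv.Perm (Fin n)} (h : Monotone (y ∘ ⇑τ)) :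
    y ∘ ⇑τ = sortVec y :=
  Tuple.comp_sort_eq_comp_iff_monotone.2 h

/-- A non-decreasing vector is its own `sort`. [cite: KaibelPashkovich2011, §4.1.2 (arXiv p. 10: "`Φ(y) = sort(y)`")] -/
theorem sortVec_eq_self_of_monotone {y : Fin n → ℝ} (h : Monotone y) : sortVec y = y := by
  have := comp_eq_sortVec_of_monotone (y := y) (τ := 1) (by simpa using h)
  simpa using this.symm

/-- Kaibel–Pashkovich's "sorting network" (`τ* ∘ ⋯ ∘ τ*(y) = sort(y)` for all `y`) is the tree's
`ComparatorNetwork.IsSorting`: a sorting network outputs `sort(y)`.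
[cite: KaibelPashkovich2011, §4.1.2 (arXiv p. 10)] -/
theorem ComparatorNetwork.IsSorting.apply_eq_sortVec {N : ComparatorNetwork n} (hN : N.IsSorting)
    (y : Fin n → ℝ) : N.apply y = sortVec y := by
  obtain ⟨τ, hτ⟩ := ComparatorNetwork.exists_apply_eq_comp_perm N y
  have hmono : Monotone (y ∘ ⇑τ) := hτ ▸ hN y
  rw [hτ]
  exact comp_eq_sortVec_of_monotone hmono

/-- The normal vector `e_k − e_ℓ` of the transposition relation `T_{k,ℓ} = R_{e_k − e_ℓ, 0}`.
[cite: KaibelPashkovich2011, §4.1.2 (arXiv p. 10)] -/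
def transVec (c : Fin n × Fin n) : Fin n → ℝ := Pi.single c.1 1 - Pi.single c.2 1

/-- `⟨e_k − e_ℓ, y⟩ = y_k − y_ℓ`. [cite: KaibelPashkovich2011, §4.1.2 (arXiv p. 10)] -/
theorem transVec_dotProduct (c : Fin n × Fin n) (y : Fin n → ℝ) : transVec c ⬝ᵥ y = y c.1 - y c.2 := by
  simp [transVec, sub_dotProduct, single_dotProduct]

/-- `e_k − e_ℓ ≠ 0` for `k ≠ ℓ`. [cite: KaibelPashkovich2011, §4.1.2 (arXiv p. 10: "with `k_i ≠ ℓ_i`")] -/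
theorem transVec_ne_zero {c : Fin n × Fin n} (h : c.1 ≠ c.2) : transVec c ≠ 0 := by
  intro h0
  have := congrFun h0 c.1
  rw [transVec, Pi.sub_apply, Pi.single_eq_same, Pi.single_eq_of_ne h, Pi.zero_apply] at this
  norm_num at this

/-- "The corresponding reflection `τ_{k,ℓ} = ϱ_{H_{k,ℓ}}` … is the transposition of coordinates `k` and
`ℓ`." [cite: KaibelPashkovich2011, §4.1.2 (arXiv p. 10)] -/
theorem reflectAt_transVec {c : Fin n × Fin n} (h : c.1 ≠ c.2) (y : Fin n → ℝ) :
    reflectAt (transVec c) 0 y = y ∘ ⇑(Equiv.swap c.1 c.2) := by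
  have h1 : transVec c ⬝ᵥ y = y c.1 - y c.2 := transVec_dotProduct c y
  have h2 : transVec c ⬝ᵥ transVec c = 2 := by
    rw [transVec_dotProduct, transVec, Pi.sub_apply, Pi.sub_apply, Pi.single_eq_same,
      Pi.single_eq_same, Pi.single_eq_of_ne h, Pi.single_eq_of_ne (Ne.symm h)]
    norm_num
  ext i
  rw [reflectAt, h1, h2]
  simp only [Pi.add_apply, Pi.smul_apply, smul_eq_mul, Function.comp_apply, transVec, Pi.sub_apply]
  by_cases hi1 : i = c.1
  · rw [hi1, Equiv.swap_apply_left, Pi.single_eq_same, Pi.single_eq_of_ne h]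
    ring
  · by_cases hi2 : i = c.2
    · rw [hi2, Equiv.swap_apply_right, Pi.single_eq_same, Pi.single_eq_of_ne (Ne.symm h)]
      ring
    · rw [Equiv.swap_apply_of_ne_of_ne hi1 hi2, Pi.single_eq_of_ne hi1, Pi.single_eq_of_ne hi2]
      ring

/-- "The map `τ*_{k,ℓ}` (assigning canonical preimages) is given by `τ*_{k,ℓ}(y) = τ_{k,ℓ}(y)` if
`y_k > y_ℓ`, `y` otherwise" — i.e. the comparator writing `min` into `k` and `max` into `ℓ`
(the tree's `ComparatorNetwork.comparator (k, ℓ)`). [cite: KaibelPashkovich2011, §4.1.2 (arXiv p. 10)] -/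
theorem canon_transVec {c : Fin n × Fin n} (h : c.1 ≠ c.2) (y : Fin n → ℝ) :
    canon (transVec c) 0 y = ComparatorNetwork.comparator c y := by
  by_cases hy : transVec c ⬝ᵥ y ≤ 0
  · rw [canon, if_pos hy]
    rw [transVec_dotProduct] at hy
    funext s
    simp only [ComparatorNetwork.comparator]
    split_ifs with h1 h2
    · rw [h1, min_eq_left (by linarith)]
    · rw [h2, max_eq_right (by linarith)]
    · rfl
  · rw [canon, if_neg hy, reflectAt_transVec h]
    rw [transVec_dotProduct] at hy
    funext s
    simp only [ComparatorNetwork.comparator, Function.comp_apply]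
    split_ifs with h1 h2
    · rw [h1, Equiv.swap_apply_left, min_eq_right (by linarith)]
    · rw [h2, Equiv.swap_apply_right, max_eq_left (by linarith)]
    · rw [Equiv.swap_apply_of_ne_of_ne h1 h2]

/-- A degenerate comparator `(k, k)` does nothing. [cite: Goemans2015, §3 (PDF p. 3)] -/
theorem ComparatorNetwork.comparator_of_eq {c : Fin n × Fin n} (h : c.1 = c.2) (y : Fin n → ℝ) :
    ComparatorNetwork.comparator c y = y := by
  funext s
  simp only [ComparatorNetwork.comparator]
  split_ifs with h1 h2
  · rw [h1, ← h, min_self]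
  · rw [h2, h, max_self]
  · rfl

/-- The sequence of transposition relations `(T_{k_1,ℓ_1}, …, T_{k_r,ℓ_r})` attached to a comparator
network of the tree. The tree applies the HEAD comparator first while `ϱ*_1 ∘ ⋯ ∘ ϱ*_r` applies the
LAST relation's canonical map first, so the list is reversed; degenerate comparators `(k, k)` (allowed
by the tree's type, forbidden in print: "with `k_i ≠ ℓ_i`") are dropped.
[cite: KaibelPashkovich2011, Prop. 5 (arXiv p. 10)] -/
def transSeq (N : ComparatorNetwork n) : List ((Fin n → ℝ) × ℝ) :=
  ((N.filter fun c => c.1 ≠ c.2).reverse).map fun c => (transVec c, 0)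

/-- Dropping a degenerate head comparator. [cite: KaibelPashkovich2011, Prop. 5 (arXiv p. 10)] -/
theorem transSeq_cons_of_eq {c : Fin n × Fin n} (h : c.1 = c.2) (N : ComparatorNetwork n) :
    transSeq (c :: N) = transSeq N := by
  simp [transSeq, h]

/-- The head comparator becomes the LAST relation. [cite: KaibelPashkovich2011, Prop. 5 (arXiv p. 10)] -/
theorem transSeq_cons_of_ne {c : Fin n × Fin n} (h : c.1 ≠ c.2) (N : ComparatorNetwork n) :
    transSeq (c :: N) = transSeq N ++ [(transVec c, 0)] := by
  simp [transSeq, h]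

/-- The sequence is no longer than the network. [cite: KaibelPashkovich2011, Thm. 4 (arXiv p. 10)] -/
theorem length_transSeq_le (N : ComparatorNetwork n) : (transSeq N).length ≤ N.length := by
  simp only [transSeq, List.length_map, List.length_reverse]
  exact List.length_filter_le _ _

/-- Members of the sequence are transposition relations `T_{k,ℓ}`, `k ≠ ℓ`.
[cite: KaibelPashkovich2011, Prop. 5 (arXiv p. 10)] -/
theorem mem_transSeq {N : ComparatorNetwork n} {h : (Fin n → ℝ) × ℝ} (hh : h ∈ transSeq N) :
    ∃ c ∈ N, c.1 ≠ c.2 ∧ h = (transVec c, 0) := by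
  simp only [transSeq, List.mem_map, List.mem_reverse, List.mem_filter] at hh
  obtain ⟨c, ⟨hc, hne⟩, rfl⟩ := hh
  exact ⟨c, hc, by simpa using hne, rfl⟩

/-- `canonSeq (l₁ ++ l₂) = canonSeq l₁ ∘ canonSeq l₂`. [cite: KaibelPashkovich2011, §3 eq. (3) (arXiv p. 7)] -/
theorem canonSeq_append (l₁ l₂ : List ((Fin n → ℝ) × ℝ)) (y : Fin n → ℝ) :
    canonSeq (l₁ ++ l₂) y = canonSeq l₁ (canonSeq l₂ y) := by
  induction l₁ with
  | nil => rfl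
  | cons hd t ih => simp [canonSeq, ih]

/-- **"`τ*_{k_1 ℓ_1} ∘ ⋯ ∘ τ*_{k_r ℓ_r}(y)`" is the output of the comparator network on `y`.**
[cite: KaibelPashkovich2011, §4.1.2 (arXiv p. 10)] -/
theorem canonSeq_transSeq (N : ComparatorNetwork n) (y : Fin n → ℝ) :
    canonSeq (transSeq N) y = N.apply y := by
  induction N generalizing y with
  | nil => rfl
  | cons c N ih =>
    by_cases h : c.1 = c.2
    · rw [transSeq_cons_of_eq h, ComparatorNetwork.apply_cons, ComparatorNetwork.comparator_of_eq h, ih]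
    · rw [transSeq_cons_of_ne h, canonSeq_append_singleton, ComparatorNetwork.apply_cons, ih]
      dsimp only
      rw [canon_transVec h]

/-- For a sorting network, `τ* ∘ ⋯ ∘ τ*(y) = sort(y)` — the printed definition of a sorting network.
[cite: KaibelPashkovich2011, §4.1.2 (arXiv p. 10)] -/
theorem ComparatorNetwork.IsSorting.canonSeq_transSeq {N : ComparatorNetwork n} (hN : N.IsSorting)
    (y : Fin n → ℝ) : canonSeq (transSeq N) y = sortVec y := by
  rw [Literature.Combinatorics.Optimization.canonSeq_transSeq, hN.apply_eq_sortVec]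

/-- `Π_{A_{n−1}}(conv V) = conv {γ.v}`. [cite: KaibelPashkovich2011, Prop. 5, proof (arXiv p. 10: "`Q = conv(W)` with `W = {γ.v}`")] -/
theorem permHull_convexHull (V : Set (Fin n → ℝ)) :
    permHull (convexHull ℝ V) = convexHull ℝ (⋃ σ : Equiv.Perm (Fin n), (fun x : Fin n → ℝ => x ∘ ⇑σ) '' V) :=
  convexHull_iUnion_image_convexHull (fun σ : Equiv.Perm (Fin n) => LinearMap.funLeft ℝ ℝ ⇑σ) V

/-- `P ⊆ Π_{A_{n−1}}(P)` (take `γ = id`). [cite: KaibelPashkovich2011, Prop. 5, proof (arXiv p. 10: "the first condition of Theorem 1 is satisfied")] -/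
theorem subset_permHull (P : Set (Fin n → ℝ)) : P ⊆ permHull P := fun x hx =>
  subset_convexHull ℝ _ (Set.mem_iUnion.2 ⟨1, x, hx, by simp⟩)

/-- `Π_{A_{n−1}}(P)` is closed under every coordinate permutation, in particular under the
transpositions `τ_{k,ℓ}`. [cite: KaibelPashkovich2011, Prop. 5, proof (arXiv p. 10: "`ϱ_{H_i}(Q) ⊆ Q`")] -/
theorem comp_perm_mem_permHull {P : Set (Fin n → ℝ)} (τ : Equiv.Perm (Fin n)) {x : Fin n → ℝ}
    (hx : x ∈ permHull P) : x ∘ ⇑τ ∈ permHull P := by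
  have himg : (fun x : Fin n → ℝ => x ∘ ⇑τ) '' permHull P =
      convexHull ℝ ((fun x : Fin n → ℝ => x ∘ ⇑τ) '' ⋃ σ : Equiv.Perm (Fin n), (fun x : Fin n → ℝ => x ∘ ⇑σ) '' P) :=
    (LinearMap.funLeft ℝ ℝ ⇑τ).image_convexHull _
  have hsub : (fun x : Fin n → ℝ => x ∘ ⇑τ) '' (⋃ σ : Equiv.Perm (Fin n), (fun x : Fin n → ℝ => x ∘ ⇑σ) '' P) ⊆
      ⋃ σ : Equiv.Perm (Fin n), (fun x : Fin n → ℝ => x ∘ ⇑σ) '' P := by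
    rintro _ ⟨y, hy, rfl⟩
    obtain ⟨σ, ⟨z, hz, rfl⟩⟩ := Set.mem_iUnion.1 hy
    refine Set.mem_iUnion.2 ⟨σ * τ, z, hz, ?_⟩
    simp only [Equiv.Perm.coe_mul, Function.comp_assoc]
  have : x ∘ ⇑τ ∈ (fun x : Fin n → ℝ => x ∘ ⇑τ) '' permHull P := ⟨x, hx, rfl⟩
  rw [himg] at this
  exact convexHull_mono hsub this

/-- **KP11 Proposition 5.** For a sorting network and `P = conv V` with `sort(v) ∈ P` for all `v ∈ V`,
the sequence of transposition relations maps `P` onto `Π_{A_{n−1}}(P)`.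
[cite: KaibelPashkovich2011, Prop. 5 (arXiv p. 10)] -/
theorem KaibelPashkovich2011_prop5 {N : ComparatorNetwork n} (hN : N.IsSorting) {P V : Set (Fin n → ℝ)}
    (hPV : P = convexHull ℝ V) (hsort : ∀ v ∈ V, sortVec v ∈ P) :
    seqImage (transSeq N) P = permHull P := by
  apply KaibelPashkovich2011_thm1 (W := ⋃ σ : Equiv.Perm (Fin n), (fun x : Fin n → ℝ => x ∘ ⇑σ) '' V)
  · rw [hPV, permHull_convexHull]
  · rw [hPV]; exact convex_convexHull ℝ V
  · exact subset_permHull P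
  · intro h hh
    obtain ⟨c, -, hne, rfl⟩ := mem_transSeq hh
    exact transVec_ne_zero hne
  · intro h hh x hx
    obtain ⟨c, -, hne, rfl⟩ := mem_transSeq hh
    dsimp only
    rw [reflectAt_transVec hne]
    exact comp_perm_mem_permHull _ hx
  · intro w hw
    obtain ⟨σ, ⟨v, hv, rfl⟩⟩ := Set.mem_iUnion.1 hw
    dsimp only
    rw [hN.canonSeq_transSeq, sortVec_comp_perm]
    exact hsort v hv

/-- **KP11 Theorem 4** (with an explicit sorting network of `r'` comparators in place of
`O(n log n)`): if `P = conv V` with `sort(v) ∈ P` for all `v ∈ V` has an EF with `r` inequalities,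
then `Π_{A_{n−1}}(P)` has one with `r + 2r'` inequalities. [cite: KaibelPashkovich2011, Thm. 4 (arXiv p. 10)] -/
theorem KaibelPashkovich2011_thm4 {N : ComparatorNetwork n} (hN : N.IsSorting) {P V : Set (Fin n → ℝ)}
    (hPV : P = convexHull ℝ V) (hsort : ∀ v ∈ V, sortVec v ∈ P) {r : ℕ} (h : HasEFOfSize P r) :
    HasEFOfSize (permHull P) (r + 2 * N.length) := by
  have h' := h.seqImage (transSeq N)
  rw [KaibelPashkovich2011_prop5 hN hPV hsort] at h'
  have := length_transSeq_le N
  exact h'.of_le (by omega)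

/-- **KP11 Theorem 4, unconditionally `r + O(n log² n)`**: with Batcher's odd–even merge sort restricted
to `n` lines (the tree's `oeSort`, `IsSorting.restrict`), `xc(Π_{A_{n−1}}(P)) ≤ r + n(⌈log₂ n⌉² + 4)`
(the printed `r + O(n log n)` needs the AKS network). [cite: KaibelPashkovich2011, Thm. 4 (arXiv p. 10)] -/
theorem KaibelPashkovich2011_thm4_nlogsq (hn : 1 ≤ n) {P V : Set (Fin n → ℝ)}
    (hPV : P = convexHull ℝ V) (hsort : ∀ v ∈ V, sortVec v ∈ P) {r : ℕ} (h : HasEFOfSize P r) :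
    HasEFOfSize (permHull P) (r + n * (Nat.clog 2 n * Nat.clog 2 n + 4)) := by
  obtain ⟨T, hT, hlen⟩ := (ComparatorNetwork.isSorting_oeSort (Nat.clog 2 n)).restrict
    (Nat.le_pow_clog one_lt_two n)
  refine (KaibelPashkovich2011_thm4 hT hPV hsort h).of_le ?_
  have h1 := ComparatorNetwork.length_oeSort (Nat.clog 2 n)
  have h2 := ComparatorNetwork.two_pow_clog_le hn
  have h3 : (Nat.clog 2 n * Nat.clog 2 n + 4) * 2 ^ Nat.clog 2 n ≤
      2 * (n * (Nat.clog 2 n * Nat.clog 2 n + 4)) :=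
    calc (Nat.clog 2 n * Nat.clog 2 n + 4) * 2 ^ Nat.clog 2 n
        ≤ (Nat.clog 2 n * Nat.clog 2 n + 4) * (2 * n) := Nat.mul_le_mul_left _ h2
      _ = 2 * (n * (Nat.clog 2 n * Nat.clog 2 n + 4)) := by ring
  omega

/-- `Π_{A_{n−1}}` of the point `(1, 2, …, n)` is the permutahedron. [cite: KaibelPashkovich2011, §4.1.2 (arXiv p. 10: "`Π_{n} = Π_{A_{n−1}}(P)`")] -/
theorem permHull_singleton_sortedVec :
    permHull ({ComparatorNetwork.sortedVec n} : Set (Fin n → ℝ)) = permutahedron n := by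
  rw [permHull, permutahedron]
  congr 1
  ext x
  simp only [Set.mem_iUnion, Set.image_singleton, Set.mem_singleton_iff, Set.mem_range]
  constructor
  · rintro ⟨σ, rfl⟩
    exact ⟨σ, by rw [ComparatorNetwork.sortedVec_eq_permVec_one, ComparatorNetwork.permVec_comp_perm, one_mul]⟩
  · rintro ⟨σ, rfl⟩
    exact ⟨σ, by rw [ComparatorNetwork.sortedVec_eq_permVec_one, ComparatorNetwork.permVec_comp_perm, one_mul]⟩

/-- "Choosing the one-point polytope `P = {(1, 2, …, n)}`, Theorem 4 yields basically the same
extended formulation … of the permutahedron that has been constructed by Goemans" — here literally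
the tree's `ComparatorNetwork.Goemans2015_thm2`, re-derived. [cite: KaibelPashkovich2011, §4.1.2 (arXiv p. 10)] -/
theorem KaibelPashkovich2011_thm4_point {N : ComparatorNetwork n} (hN : N.IsSorting) :
    HasEFOfSize (permutahedron n) (2 * N.length) := by
  have h := KaibelPashkovich2011_thm4 hN (P := {ComparatorNetwork.sortedVec n})
    (V := {ComparatorNetwork.sortedVec n}) (convexHull_singleton _).symm
    (fun v hv => by
      rw [Set.mem_singleton_iff] at hv
      subst hv
      rw [Set.mem_singleton_iff]
      refine sortVec_eq_self_of_monotone fun a b hab => ?_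
      simp only [ComparatorNetwork.sortedVec]
      exact add_le_add (by exact_mod_cast hab) le_rfl)
    (hasEFOfSize_singleton _)
  rw [permHull_singleton_sortedVec, zero_add] at h
  exact h

/-! #### §4.1.3 for a general polytope: Proposition 6 and Theorem 5 -/

/-- The **`B_n`-permutahedron of `P`**: `Π_{B_n}(P) = conv ⋃ γ.ε.P` over all coordinate permutations
`γ` and sign changes `ε` ("permuting its coordinates and changing the signs of some subset of its
coordinates"). [cite: KaibelPashkovich2011, §4.1.3 (arXiv p. 10)] -/
def signPermHull (P : Set (Fin n → ℝ)) : Set (Fin n → ℝ) :=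
  convexHull ℝ (⋃ p : Equiv.Perm (Fin n) × Finset (Fin n), (fun x : Fin n → ℝ => flipSigns p.2 x ∘ ⇑p.1) '' P)

/-- `x ↦ γ.ε.x` as a linear map. [cite: KaibelPashkovich2011, §4.1.3 (arXiv p. 10)] -/
def signPermLin (p : Equiv.Perm (Fin n) × Finset (Fin n)) : (Fin n → ℝ) →ₗ[ℝ] (Fin n → ℝ) :=
  (LinearMap.funLeft ℝ ℝ ⇑p.1).comp (flipLin p.2)

/-- `signPermLin p x = (ε.x) ∘ γ`. [cite: KaibelPashkovich2011, §4.1.3 (arXiv p. 10)] -/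
@[simp] theorem signPermLin_apply (p : Equiv.Perm (Fin n) × Finset (Fin n)) (x : Fin n → ℝ) :
    signPermLin p x = flipSigns p.2 x ∘ ⇑p.1 := rfl

/-- `Π_{B_n}(conv V) = conv {γ.ε.v}`. [cite: KaibelPashkovich2011, Prop. 6, proof (arXiv p. 10: "`Q = conv(W)` with `W = {γ.ε.v}`")] -/
theorem signPermHull_convexHull (V : Set (Fin n → ℝ)) :
    signPermHull (convexHull ℝ V) =
      convexHull ℝ (⋃ p : Equiv.Perm (Fin n) × Finset (Fin n), (fun x : Fin n → ℝ => flipSigns p.2 x ∘ ⇑p.1) '' V) :=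
  convexHull_iUnion_image_convexHull (fun p : Equiv.Perm (Fin n) × Finset (Fin n) => signPermLin p) V

/-- `P ⊆ Π_{B_n}(P)`. [cite: KaibelPashkovich2011, Prop. 6, proof (arXiv p. 10)] -/
theorem subset_signPermHull (P : Set (Fin n → ℝ)) : P ⊆ signPermHull P := fun x hx =>
  subset_convexHull ℝ _ (Set.mem_iUnion.2 ⟨(1, ∅), x, hx, by simp⟩)

/-- A sign change after a permutation is a permutation after a sign change:
`σ_k(x ∘ γ) = (σ_{γ(k)} x) ∘ γ`. [cite: KaibelPashkovich2011, §4.1.3 (arXiv p. 10)] -/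
theorem flipSigns_singleton_comp_perm (k : Fin n) (x : Fin n → ℝ) (σ : Equiv.Perm (Fin n)) :
    flipSigns {k} (x ∘ ⇑σ) = flipSigns {σ k} x ∘ ⇑σ := by
  ext i
  simp only [flipSigns, Finset.mem_singleton, Function.comp_apply, EmbeddingLike.apply_eq_iff_eq]

/-- `Π_{B_n}(P)` is closed under the maps `x ↦ (σ_T x) ∘ τ` (`T = ∅`: transpositions; `τ = id`: sign
changes). [cite: KaibelPashkovich2011, Prop. 6, proof (arXiv p. 10: "the first condition of Theorem 1 is satisfied")] -/
theorem signPerm_mem_signPermHull {P : Set (Fin n → ℝ)} (τ : Equiv.Perm (Fin n)) (k : Fin n) (b : Bool)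
    {x : Fin n → ℝ} (hx : x ∈ signPermHull P) :
    flipSigns (if b then {k} else ∅) x ∘ ⇑τ ∈ signPermHull P := by
  set W := ⋃ p : Equiv.Perm (Fin n) × Finset (Fin n), (fun x : Fin n → ℝ => flipSigns p.2 x ∘ ⇑p.1) '' P
  have himg : (signPermLin (τ, if b then {k} else ∅) : (Fin n → ℝ) → (Fin n → ℝ)) '' signPermHull P =
      convexHull ℝ ((signPermLin (τ, if b then {k} else ∅) : (Fin n → ℝ) → (Fin n → ℝ)) '' W) :=
    (signPermLin _).image_convexHull _
  have hsub : (signPermLin (τ, if b then {k} else ∅) : (Fin n → ℝ) → (Fin n → ℝ)) '' W ⊆ W := by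
    rintro _ ⟨y, hy, rfl⟩
    obtain ⟨p, ⟨z, hz, rfl⟩⟩ := Set.mem_iUnion.1 hy
    rw [signPermLin_apply]
    dsimp only
    cases b
    · refine Set.mem_iUnion.2 ⟨(p.1 * τ, p.2), z, hz, ?_⟩
      simp only [Bool.false_eq_true, ↓reduceIte, flipSigns_empty, Equiv.Perm.coe_mul,
        Function.comp_assoc]
    · refine Set.mem_iUnion.2
        ⟨(p.1 * τ, if p.1 k ∈ p.2 then p.2.erase (p.1 k) else insert (p.1 k) p.2), z, hz, ?_⟩
      simp only [↓reduceIte, Equiv.Perm.coe_mul]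
      rw [flipSigns_singleton_comp_perm, flipSigns_singleton_flipSigns, Function.comp_assoc]
  have : flipSigns (if b then {k} else ∅) x ∘ ⇑τ ∈
      (signPermLin (τ, if b then {k} else ∅) : (Fin n → ℝ) → (Fin n → ℝ)) '' signPermHull P :=
    ⟨x, hx, rfl⟩
  rw [himg] at this
  exact convexHull_mono hsub this

/-- `|x ∘ γ| = |x| ∘ γ`. [cite: KaibelPashkovich2011, §4.1.3 (arXiv p. 10)] -/
theorem absVec_comp_perm (x : Fin n → ℝ) (σ : Equiv.Perm (Fin n)) : absVec (x ∘ ⇑σ) = absVec x ∘ ⇑σ := rfl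

/-- **KP11 Proposition 6.** For a sorting network, the sequence `(T_{k_1,ℓ_1}, …, T_{k_r,ℓ_r}, S_1, …,
S_n)` maps `P = conv V` onto `Π_{B_n}(P)` provided `sort(|v|) ∈ P` for every `v ∈ V`.
[cite: KaibelPashkovich2011, Prop. 6 (arXiv p. 10)] -/
theorem KaibelPashkovich2011_prop6 {N : ComparatorNetwork n} (hN : N.IsSorting) {P V : Set (Fin n → ℝ)}
    (hPV : P = convexHull ℝ V) (hsortabs : ∀ v ∈ V, sortVec (absVec v) ∈ P) :
    seqImage (transSeq N ++ signSeq (Fin n)) P = signPermHull P := by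
  apply KaibelPashkovich2011_thm1
    (W := ⋃ p : Equiv.Perm (Fin n) × Finset (Fin n), (fun x : Fin n → ℝ => flipSigns p.2 x ∘ ⇑p.1) '' V)
  · rw [hPV, signPermHull_convexHull]
  · rw [hPV]; exact convex_convexHull ℝ V
  · exact subset_signPermHull P
  · intro h hh
    rcases List.mem_append.1 hh with hh | hh
    · obtain ⟨c, -, hne, rfl⟩ := mem_transSeq hh
      exact transVec_ne_zero hne
    · obtain ⟨k, -, rfl⟩ := List.mem_map.1 hh
      intro h0
      have := congrFun h0 k
      simp at this
  · intro h hh x hx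
    rcases List.mem_append.1 hh with hh | hh
    · obtain ⟨c, -, hne, rfl⟩ := mem_transSeq hh
      dsimp only
      rw [reflectAt_transVec hne]
      simpa using signPerm_mem_signPermHull (Equiv.swap c.1 c.2) c.1 false hx
    · obtain ⟨k, -, rfl⟩ := List.mem_map.1 hh
      dsimp only
      rw [reflectAt_neg_single]
      simpa using signPerm_mem_signPermHull 1 k true hx
  · intro w hw
    obtain ⟨p, ⟨v, hv, rfl⟩⟩ := Set.mem_iUnion.1 hw
    dsimp only
    rw [canonSeq_append, canonSeq_signSeq, hN.canonSeq_transSeq, absVec_comp_perm, sortVec_comp_perm,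
      absVec_flipSigns]
    exact hsortabs v hv

/-- **KP11 Theorem 5** (explicit network of `r'` comparators): under the hypotheses of Proposition 6 an
EF of `P` with `r` inequalities gives one of `Π_{B_n}(P)` with `r + 2r' + 2n` inequalities.
[cite: KaibelPashkovich2011, Thm. 5 (arXiv p. 10)] -/
theorem KaibelPashkovich2011_thm5 {N : ComparatorNetwork n} (hN : N.IsSorting) {P V : Set (Fin n → ℝ)}
    (hPV : P = convexHull ℝ V) (hsortabs : ∀ v ∈ V, sortVec (absVec v) ∈ P) {r : ℕ}
    (h : HasEFOfSize P r) : HasEFOfSize (signPermHull P) (r + 2 * N.length + 2 * n) := by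
  have h' := h.seqImage (transSeq N ++ signSeq (Fin n))
  rw [KaibelPashkovich2011_prop6 hN hPV hsortabs, List.length_append, length_signSeq,
    Fintype.card_fin] at h'
  have := length_transSeq_le N
  exact h'.of_le (by omega)

/-- **KP11 Theorem 5, unconditionally `r + O(n log² n)`**: `xc(Π_{B_n}(P)) ≤ r + n(⌈log₂ n⌉² + 4) + 2n`.
[cite: KaibelPashkovich2011, Thm. 5 (arXiv p. 10)] -/
theorem KaibelPashkovich2011_thm5_nlogsq (hn : 1 ≤ n) {P V : Set (Fin n → ℝ)}
    (hPV : P = convexHull ℝ V) (hsortabs : ∀ v ∈ V, sortVec (absVec v) ∈ P) {r : ℕ}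
    (h : HasEFOfSize P r) :
    HasEFOfSize (signPermHull P) (r + n * (Nat.clog 2 n * Nat.clog 2 n + 4) + 2 * n) := by
  obtain ⟨T, hT, hlen⟩ := (ComparatorNetwork.isSorting_oeSort (Nat.clog 2 n)).restrict
    (Nat.le_pow_clog one_lt_two n)
  refine (KaibelPashkovich2011_thm5 hT hPV hsortabs h).of_le ?_
  have h1 := ComparatorNetwork.length_oeSort (Nat.clog 2 n)
  have h2 := ComparatorNetwork.two_pow_clog_le hn
  have h3 : (Nat.clog 2 n * Nat.clog 2 n + 4) * 2 ^ Nat.clog 2 n ≤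
      2 * (n * (Nat.clog 2 n * Nat.clog 2 n + 4)) :=
    calc (Nat.clog 2 n * Nat.clog 2 n + 4) * 2 ^ Nat.clog 2 n
        ≤ (Nat.clog 2 n * Nat.clog 2 n + 4) * (2 * n) := Nat.mul_le_mul_left _ h2
      _ = 2 * (n * (Nat.clog 2 n * Nat.clog 2 n + 4)) := by ring
  omega

/-- `Π_{B_n}(P) = Π_{A_{n−1}}`-hull of the signing: the signed permutations of `(1, …, n)` span
`signing (permutahedron n)` (cf. `signing_permutahedron_eq`). [cite: KaibelPashkovich2011, §4.1.3 (arXiv p. 10)] -/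
theorem signPermHull_singleton_sortedVec :
    signPermHull ({ComparatorNetwork.sortedVec n} : Set (Fin n → ℝ)) = signing (permutahedron n) := by
  rw [signing_permutahedron_eq, signPermHull]
  congr 1
  ext x
  simp only [Set.mem_iUnion, Set.image_singleton, Set.mem_singleton_iff, Set.mem_range, Prod.exists]
  constructor
  · rintro ⟨σ, S, rfl⟩
    refine ⟨S.map (Equiv.toEmbedding σ.symm), σ, ?_⟩
    ext i
    simp [flipSigns, Finset.mem_map_equiv, ComparatorNetwork.sortedVec, permVec]
  · rintro ⟨S, σ, rfl⟩
    refine ⟨σ, S.map (Equiv.toEmbedding σ), ?_⟩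
    ext i
    simp [flipSigns, ComparatorNetwork.sortedVec, permVec]

end An

end Literature.Combinatorics.Optimization

end
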